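import Literature.Barriers.AtomisticToContinuum.OneDimensionalHardCoreFamilies
import Literature.Barriers.AtomisticToContinuum.OneDimensionalHardCoreSumRule
import Literature.Barriers.AtomisticToContinuum.OneDimensionalHardCoreRodsBessel
import Mathlib.Analysis.Fourier.AddCircle
import Mathlib.MeasureTheory.Function.L2Space
import HarnessLib

/-!
# No generalised condensation in ANY subspace: the Ky Fan step, typed (seventeenth audit of `OneDimensionalHardCore`, 2026-08-17)

Companion of `OneDimensionalHardCore.lean` and of `OneDimensionalHardCoreFamilies.lean` (sixteenth
audit: every family of `M` plane waves carries at most `7e√(NM(1 + log M))` particles), whose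
BARRIER block and scope caveat (a) left ONE reduction untyped: "for a general rank-`M` projection `P`
the occupation `Tr Pγ_N = ∑_m c_m w_m` with `0 ≤ w_m ≤ 1`, `∑_m w_m = M` (`γ_N` is diagonal in the
plane waves; Bessel), so by `c_m ≥ 0` it is at most the sum of the `M` largest `c_m` — this Ky Fan
reduction is untyped (paper-level, standard)"; consequently the tree covered arbitrary (non-plane-wave)
orthonormal families only up to `o(√N)` modes (Schur bound of the Modes companion). This file types
and proves the reduction, for square-integrable modes.

**What is typed and proved here** (all `N`, all `L > 0`; `φ̂(m) = L⁻¹∫₀ᴸ conj(e_m) φ` is `ezCoeff`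
of the rod companions, `e_m = e^{2πimx/L}`):

* `densityApply`, `girardeauForm₂`: `γ_N` as an integral operator on `L¹[0, L]` and its sesquilinear
  form `⟨φ, γ_N χ⟩` (the diagonal is the `girardeauForm` of the Narrow companion); boundedness
  `|⟨φ, γ_N χ⟩| ≤ (N/L)e^{1/2}‖φ‖₁‖χ‖₁` (`norm_girardeauForm₂_le`) and `L¹`-continuity of the
  quadratic form (`norm_girardeauForm_sub_le`), from the GLOBAL kernel bound
  `0 ≤ ρ_N(x, y) ≤ (N/L)e^{1/2}` (`girardeauDensityMatrix_le_densityBound`, periodicity of Lenard's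
  determinant).
* **Plane waves are the natural orbitals** [ForresterEtAl2003, §3.1.3]: `(γ_N e_m)(x) = c_m(N) e_m(x)`
  (`densityApply_ez`), `⟨e_m, γ_N e_{m'}⟩ = L c_m(N) δ_{mm'}` (`girardeauForm₂_ez_ez`), and for every
  `φ ∈ L²[0, L]` the DIAGONALISATION `⟨φ, γ_N φ⟩ = ∑_{m∈ℤ} c_m(N) · L|φ̂(m)|²` as an unconditional sum
  (`hasSum_momentumOccupation_mul_sq_ezCoeff`; via the form on trigonometric polynomials
  `girardeauForm₂_sum_ez`, Pythagoras `integral_norm_sq_sub_fourierPartial`, Parseval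
  `hasSum_sq_ezCoeff` = Mathlib's `hasSum_sq_fourierCoeffOn` in this file's normalisation, and the
  `L²`, `L¹` convergence of the Fourier partial sums `fourierPartial`).
* **Bessel across an orthonormal family** (`mul_sum_sq_ezCoeff_family_le_one`): for orthonormal
  `φ₀, …, φ_{M−1}` in `L²[0, L]`, `w_m := L∑_i|φ̂_i(m)|² = ∑_i|⟨e_m/√L, φ_i⟩|² ≤ 1`; and
  `∑_{m∈K} w_m ≤ M` (`sum_mul_sum_sq_ezCoeff_le_card`).
* **Greedy majorisation** (`exists_card_le_sum_mul_le`, `sum_mul_le_of_forall_card_le`): weights in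
  `[0, 1]` of total mass `≤ M` against `c ≥ 0` are dominated by the `c`-mass of an `≤ M`-subset
  (the combinatorial half of Ky Fan's maximum principle).
* **Assembly** (`subspaceOccupation N L φ = ∑_i Re⟨φ_i, γ_N φ_i⟩ = Tr(P_V γ_N)`):
  `subspaceOccupation_le`: `Tr(P_V γ_N) ≤ 7e√N√(M(1 + log M))` for EVERY orthonormal family of `M`
  square-integrable modes, all `N`, `L`; hence `Tr(P_{V_N}γ_N)/N → 0` whenever
  `dim V_N(1 + log dim V_N)/N → 0` (`tendsto_subspaceOccupation_div`), the negated conjunct shape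
  `not_exists_linear_le_subspaceOccupation`, the named fact `OneDimensionalHardCoreSubspaces` (proved,
  `oneDimensionalHardCoreSubspaces_holds`) and the consistency `oneDimensionalHardCore_of_subspaces`
  (the constant mode alone recovers `c₀(N)/N → 0`).

What stays open: the window `N/log N ≲ dim V_N = o(N)` (exactly as for plane-wave families: it needs
the per-mode law `c_m(N) ≤ C√(N/|m|)`, parent caveat (t)(3)); rods, walls and traps in subspace form.

## References

* [ForresterEtAl2003] P. J. Forrester, N. E. Frankel, T. M. Garoni, N. S. Witte, *Finite
  one-dimensional impenetrable Bose systems: occupation numbers*, Phys. Rev. A 67 (2003) 043607,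
  arXiv:cond-mat/0211126: §3.1.3 ("the eigenvalue equation `∫ρ_N(x,y)φ_j(y)dy = λ_jφ_j(x)` defines the
  natural orbitals … When the system lies on a circle the periodicity implies that the natural orbitals
  are simply plane waves, and so the eigenvalues are given by the Fourier coefficients of `ρ_N(x−y)` and
  hence the momentum distribution and the set of natural orbital occupations coincide"), §2.2.1–§2.2.2.
* [DeiftItsKrasovsky2013] P. Deift, A. Its, I. Krasovsky, Comm. Pure Appl. Math. 66 (2013)
  1360–1438, arXiv:1207.4990: Remark 8 (r34-1)–(r34-2) (Szegő's inequality behind the family law).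
* [Lenard1964] A. Lenard, J. Math. Phys. 5 (1964) 930–943 (cite-only, acq-00347).

## Design notes

Everything is stated over the objects of the statement file and of the companions
(`girardeauDensityMatrix`, `girardeauForm`, `momentumOccupation`, `familyOccupation`, `ez`,
`ezCoeff`); no existing statement or definition is changed. Auxiliary data definitions introduced
here: `densityBound`, `densityApply`, `girardeauForm₂`, `fourierPartial`, `subspaceOccupation`; ONE
named fact (`OneDimensionalHardCoreSubspaces`, D-0026), proved in this file. Orthonormality is a
plain hypothesis (`∫₀ᴸ conj(φ_i)φ_j = δ_{ij}`), the mode class is Mathlib's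
`MemLp φ 2 (volume.restrict (Set.Icc 0 L))`.
-/

noncomputable section

open MeasureTheory Filter Topology Finset Complex
open scoped BigOperators Real ComplexConjugate

namespace Literature.Barriers.AtomisticToContinuum.BoseGas

variable {n : ℕ} {L : ℝ}

/-! ### Global bounds for the one-body density matrix -/

/-- `ρ_N ≥ 0` everywhere (Lenard's formula and `R(n, t) ≥ 0`). [folklore] -/
theorem girardeauDensityMatrix_succ_nonneg (hL : 0 < L) (n : ℕ) (x y : ℝ) :
    0 ≤ girardeauDensityMatrix (n + 1) L x y := by
  rw [girardeauDensityMatrix_eq_lenardDet hL]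
  exact mul_nonneg (inv_nonneg.mpr hL.le) (lenardDet_nonneg _ _)

/-- The uniform bound `K_N = (N/L) e^{1/2}` of the Modes companion. [folklore] -/
def densityBound (n : ℕ) (L : ℝ) : ℝ := (n + 1 : ℝ) / L * Real.exp (1 / 2)

/-- `K_N ≥ 0` for `L > 0`. [folklore] -/
theorem densityBound_nonneg (hL : 0 < L) (n : ℕ) : 0 ≤ densityBound n L := by
  unfold densityBound; positivity

/-- **`ρ_N(x, y) ≤ (N/L)e^{1/2}` for ALL real `x, y`** (the bound of the Modes companion on the
square `[0, L]²`, extended by the periodicity of Lenard's determinant). [folklore] -/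
theorem girardeauDensityMatrix_le_densityBound (hL : 0 < L) (n : ℕ) (x y : ℝ) :
    girardeauDensityMatrix (n + 1) L x y ≤ densityBound n L := by
  set k : ℤ := ⌊(x - y) / L⌋ with hk
  set s : ℝ := x - y - k * L with hs
  have hs0 : 0 ≤ s := by
    have h1 : (k : ℝ) * L ≤ x - y := by
      calc (k : ℝ) * L ≤ (x - y) / L * L := by
            gcongr
            exact Int.floor_le _
        _ = x - y := by field_simp
    rw [hs]; linarith
  have hsL : s ≤ L := by
    have h1 : x - y < ((k : ℝ) + 1) * L := by
      calc x - y = (x - y) / L * L := by field_simp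
        _ < ((k : ℝ) + 1) * L := by
            gcongr
            exact Int.lt_floor_add_one _
    rw [hs]; linarith
  have hρ : girardeauDensityMatrix (n + 1) L x y = girardeauDensityMatrix (n + 1) L s 0 := by
    rw [girardeauDensityMatrix_eq_lenardDet hL, girardeauDensityMatrix_eq_lenardDet hL]
    congr 1
    rw [sub_zero, hs,
      show 2 * π * (x - y - k * L) / L = 2 * π * (x - y) / L - k * (2 * π) by field_simp]
    exact ((lenardDet_periodic n).sub_int_mul_eq k).symm
  rw [hρ]
  exact girardeauDensityMatrix_le_const hL n ⟨hs0, hsL⟩ ⟨le_rfl, hL.le⟩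

/-- `‖ρ_N(x, y)‖ ≤ (N/L)e^{1/2}` as a complex number. [folklore] -/
theorem norm_girardeauDensityMatrix_le (hL : 0 < L) (n : ℕ) (x y : ℝ) :
    ‖(girardeauDensityMatrix (n + 1) L x y : ℂ)‖ ≤ densityBound n L := by
  rw [Complex.norm_real, Real.norm_eq_abs,
    abs_of_nonneg (girardeauDensityMatrix_succ_nonneg hL n x y)]
  exact girardeauDensityMatrix_le_densityBound hL n x y

/-- `x ↦ ρ_N(x, y)` is continuous (Lenard's formula). [folklore] -/
theorem continuous_girardeauDensityMatrix_left (hL : 0 < L) (n : ℕ) (y : ℝ) :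
    Continuous fun x => (girardeauDensityMatrix (n + 1) L x y : ℂ) := by
  have h : (fun x => (girardeauDensityMatrix (n + 1) L x y : ℂ)) =
      fun x => (((L⁻¹ * lenardDet n (2 * π * (x - y) / L) : ℝ)) : ℂ) := by
    funext x
    rw [girardeauDensityMatrix_eq_lenardDet hL]
  rw [h]
  exact Complex.continuous_ofReal.comp
    (continuous_const.mul ((continuous_lenardDet n).comp (by fun_prop)))

/-- `y ↦ ρ_N(x, y)` is continuous (Lenard's formula). [folklore] -/
theorem continuous_girardeauDensityMatrix_right (hL : 0 < L) (n : ℕ) (x : ℝ) :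
    Continuous fun y => (girardeauDensityMatrix (n + 1) L x y : ℂ) := by
  have h : (fun y => (girardeauDensityMatrix (n + 1) L x y : ℂ)) =
      fun y => (((L⁻¹ * lenardDet n (2 * π * (x - y) / L) : ℝ)) : ℂ) := by
    funext y
    rw [girardeauDensityMatrix_eq_lenardDet hL]
  rw [h]
  exact Complex.continuous_ofReal.comp
    (continuous_const.mul ((continuous_lenardDet n).comp (by fun_prop)))

/-! ### The one-body density matrix as an integral operator -/

/-- `(γ_N χ)(x) = ∫₀ᴸ ρ_N(x, y) χ(y) dy`: the one-body density matrix acting on a mode.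
[cite: ForresterEtAl2003, §3.1 (natural orbitals and their occupations)] -/
def densityApply (N : ℕ) (L : ℝ) (χ : ℝ → ℂ) (x : ℝ) : ℂ :=
  ∫ y in Set.Icc 0 L, (girardeauDensityMatrix N L x y : ℂ) * χ y

/-- For `χ ∈ L¹[0, L]` the integrand of `(γ_N χ)(x)` is integrable. [folklore] -/
theorem integrableOn_density_mul (hL : 0 < L) (n : ℕ) {χ : ℝ → ℂ}
    (hχ : IntegrableOn χ (Set.Icc 0 L)) (x : ℝ) :
    IntegrableOn (fun y => (girardeauDensityMatrix (n + 1) L x y : ℂ) * χ y) (Set.Icc 0 L) :=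
  Integrable.bdd_mul hχ (continuous_girardeauDensityMatrix_right hL n x).aestronglyMeasurable
    (Filter.Eventually.of_forall fun y => norm_girardeauDensityMatrix_le hL n x y)

/-- `‖(γ_N χ)(x)‖ ≤ (N/L)e^{1/2} ‖χ‖₁`. [folklore] -/
theorem norm_densityApply_le (hL : 0 < L) (n : ℕ) {χ : ℝ → ℂ}
    (hχ : IntegrableOn χ (Set.Icc 0 L)) (x : ℝ) :
    ‖densityApply (n + 1) L χ x‖ ≤ densityBound n L * ∫ y in Set.Icc 0 L, ‖χ y‖ := by
  unfold densityApply
  rw [← integral_const_mul]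
  refine norm_integral_le_of_norm_le (hχ.norm.const_mul _)
    (Filter.Eventually.of_forall fun y => ?_)
  rw [norm_mul]
  exact mul_le_mul_of_nonneg_right (norm_girardeauDensityMatrix_le hL n x y) (norm_nonneg _)

/-- `x ↦ (γ_N χ)(x)` is continuous for `χ ∈ L¹[0, L]` (dominated convergence). [folklore] -/
theorem continuous_densityApply (hL : 0 < L) (n : ℕ) {χ : ℝ → ℂ}
    (hχ : IntegrableOn χ (Set.Icc 0 L)) :
    Continuous (densityApply (n + 1) L χ) := by
  unfold densityApply
  refine continuous_of_dominated (μ := volume.restrict (Set.Icc 0 L))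
    (bound := fun y => densityBound n L * ‖χ y‖) ?_ ?_ ?_ ?_
  · intro x
    exact (integrableOn_density_mul hL n hχ x).aestronglyMeasurable
  · intro x
    refine Filter.Eventually.of_forall fun y => ?_
    rw [norm_mul]
    exact mul_le_mul_of_nonneg_right (norm_girardeauDensityMatrix_le hL n x y) (norm_nonneg _)
  · exact hχ.norm.const_mul _
  · exact Filter.Eventually.of_forall fun y =>
      (continuous_girardeauDensityMatrix_left hL n y).mul continuous_const

/-- Additivity of `γ_N` on `L¹[0, L]`. [folklore] -/
theorem densityApply_sub (hL : 0 < L) (n : ℕ) {χ₁ χ₂ : ℝ → ℂ}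
    (h₁ : IntegrableOn χ₁ (Set.Icc 0 L)) (h₂ : IntegrableOn χ₂ (Set.Icc 0 L)) (x : ℝ) :
    densityApply (n + 1) L (fun y => χ₁ y - χ₂ y) x =
      densityApply (n + 1) L χ₁ x - densityApply (n + 1) L χ₂ x := by
  unfold densityApply
  rw [← integral_sub (integrableOn_density_mul hL n h₁ x) (integrableOn_density_mul hL n h₂ x)]
  refine integral_congr_ae (Filter.Eventually.of_forall fun y => ?_)
  simp only
  ring

/-! ### The sesquilinear form `⟨φ, γ_N χ⟩` -/

/-- The sesquilinear form `⟨φ, γ_N χ⟩ = ∫₀ᴸ∫₀ᴸ conj φ(x) ρ_N(x, y) χ(y) dy dx` of the one-body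
density matrix; `⟨φ, γ_N φ⟩` is the `girardeauForm` of the Narrow companion.
[cite: ForresterEtAl2003, §3.1 (natural orbitals and their occupations)] -/
def girardeauForm₂ (N : ℕ) (L : ℝ) (φ χ : ℝ → ℂ) : ℂ :=
  ∫ x in Set.Icc 0 L, ∫ y in Set.Icc 0 L, conj (φ x) * (girardeauDensityMatrix N L x y : ℂ) * χ y

/-- The diagonal of the sesquilinear form is the quadratic form. [folklore] -/
theorem girardeauForm₂_self (N : ℕ) (L : ℝ) (φ : ℝ → ℂ) :
    girardeauForm₂ N L φ φ = girardeauForm N L φ := rfl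

/-- `⟨φ, γ_N χ⟩ = ∫₀ᴸ conj φ(x) (γ_N χ)(x) dx`. [folklore] -/
theorem girardeauForm₂_eq_integral_densityApply (N : ℕ) (L : ℝ) (φ χ : ℝ → ℂ) :
    girardeauForm₂ N L φ χ = ∫ x in Set.Icc 0 L, conj (φ x) * densityApply N L χ x := by
  unfold girardeauForm₂ densityApply
  refine integral_congr_ae (Filter.Eventually.of_forall fun x => ?_)
  simp only
  rw [← integral_const_mul]
  refine integral_congr_ae (Filter.Eventually.of_forall fun y => ?_)
  simp only
  ring

/-- Complex conjugation preserves integrability on a set. [folklore] -/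
theorem integrableOn_conj {φ : ℝ → ℂ} {s : Set ℝ} (hφ : IntegrableOn φ s) :
    IntegrableOn (fun x => conj (φ x)) s :=
  Integrable.mono' hφ.norm
    (Complex.continuous_conj.comp_aestronglyMeasurable hφ.aestronglyMeasurable)
    (Filter.Eventually.of_forall fun x => by rw [Complex.norm_conj])

/-- The outer integrand of `⟨φ, γ_N χ⟩` is integrable for `φ, χ ∈ L¹[0, L]`. [folklore] -/
theorem integrableOn_conj_mul_densityApply (hL : 0 < L) (n : ℕ) {φ χ : ℝ → ℂ}
    (hφ : IntegrableOn φ (Set.Icc 0 L)) (hχ : IntegrableOn χ (Set.Icc 0 L)) :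
    IntegrableOn (fun x => conj (φ x) * densityApply (n + 1) L χ x) (Set.Icc 0 L) :=
  Integrable.mul_bdd (integrableOn_conj hφ) (continuous_densityApply hL n hχ).aestronglyMeasurable
    (Filter.Eventually.of_forall fun x => norm_densityApply_le hL n hχ x)

/-- **Boundedness of the form on `L¹`**: `|⟨φ, γ_N χ⟩| ≤ (N/L)e^{1/2} ‖φ‖₁ ‖χ‖₁`. [folklore] -/
theorem norm_girardeauForm₂_le (hL : 0 < L) (n : ℕ) {φ χ : ℝ → ℂ}
    (hφ : IntegrableOn φ (Set.Icc 0 L)) (hχ : IntegrableOn χ (Set.Icc 0 L)) :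
    ‖girardeauForm₂ (n + 1) L φ χ‖ ≤
      densityBound n L * (∫ x in Set.Icc 0 L, ‖φ x‖) * ∫ y in Set.Icc 0 L, ‖χ y‖ := by
  rw [girardeauForm₂_eq_integral_densityApply]
  have h := norm_integral_le_of_norm_le (μ := volume.restrict (Set.Icc 0 L))
    (f := fun x => conj (φ x) * densityApply (n + 1) L χ x)
    (g := fun x => ‖φ x‖ * (densityBound n L * ∫ y in Set.Icc 0 L, ‖χ y‖))
    (hφ.norm.mul_const _) (Filter.Eventually.of_forall fun x => by
      rw [norm_mul, Complex.norm_conj]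
      exact mul_le_mul_of_nonneg_left (norm_densityApply_le hL n hχ x) (norm_nonneg _))
  rw [integral_mul_const] at h
  calc ‖∫ x in Set.Icc 0 L, conj (φ x) * densityApply (n + 1) L χ x‖
      ≤ (∫ x in Set.Icc 0 L, ‖φ x‖) * (densityBound n L * ∫ y in Set.Icc 0 L, ‖χ y‖) := h
    _ = _ := by ring

/-- Additivity in the first argument. [folklore] -/
theorem girardeauForm₂_sub_left (hL : 0 < L) (n : ℕ) {φ₁ φ₂ χ : ℝ → ℂ}
    (h₁ : IntegrableOn φ₁ (Set.Icc 0 L)) (h₂ : IntegrableOn φ₂ (Set.Icc 0 L))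
    (hχ : IntegrableOn χ (Set.Icc 0 L)) :
    girardeauForm₂ (n + 1) L (fun x => φ₁ x - φ₂ x) χ =
      girardeauForm₂ (n + 1) L φ₁ χ - girardeauForm₂ (n + 1) L φ₂ χ := by
  simp only [girardeauForm₂_eq_integral_densityApply]
  rw [← integral_sub (integrableOn_conj_mul_densityApply hL n h₁ hχ)
    (integrableOn_conj_mul_densityApply hL n h₂ hχ)]
  refine integral_congr_ae (Filter.Eventually.of_forall fun x => ?_)
  simp only [map_sub]
  ring

/-- Additivity in the second argument. [folklore] -/
theorem girardeauForm₂_sub_right (hL : 0 < L) (n : ℕ) {φ χ₁ χ₂ : ℝ → ℂ}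
    (hφ : IntegrableOn φ (Set.Icc 0 L)) (h₁ : IntegrableOn χ₁ (Set.Icc 0 L))
    (h₂ : IntegrableOn χ₂ (Set.Icc 0 L)) :
    girardeauForm₂ (n + 1) L φ (fun y => χ₁ y - χ₂ y) =
      girardeauForm₂ (n + 1) L φ χ₁ - girardeauForm₂ (n + 1) L φ χ₂ := by
  simp only [girardeauForm₂_eq_integral_densityApply]
  rw [← integral_sub (integrableOn_conj_mul_densityApply hL n hφ h₁)
    (integrableOn_conj_mul_densityApply hL n hφ h₂)]
  refine integral_congr_ae (Filter.Eventually.of_forall fun x => ?_)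
  simp only
  rw [densityApply_sub hL n h₁ h₂ x]
  ring

/-- **Continuity of the quadratic form on `L¹`**:
`|⟨φ, γ_N φ⟩ − ⟨p, γ_N p⟩| ≤ (N/L)e^{1/2} ‖φ − p‖₁ (‖φ‖₁ + ‖p‖₁)`
(`⟨φ, γφ⟩ − ⟨p, γp⟩ = ⟨φ − p, γφ⟩ + ⟨p, γ(φ − p)⟩`). [folklore] -/
theorem norm_girardeauForm_sub_le (hL : 0 < L) (n : ℕ) {φ p : ℝ → ℂ}
    (hφ : IntegrableOn φ (Set.Icc 0 L)) (hp : IntegrableOn p (Set.Icc 0 L)) :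
    ‖girardeauForm (n + 1) L φ - girardeauForm (n + 1) L p‖ ≤
      densityBound n L * (∫ x in Set.Icc 0 L, ‖φ x - p x‖) *
        ((∫ x in Set.Icc 0 L, ‖φ x‖) + ∫ x in Set.Icc 0 L, ‖p x‖) := by
  have hd : IntegrableOn (fun x => φ x - p x) (Set.Icc 0 L) := hφ.sub hp
  have key : girardeauForm (n + 1) L φ - girardeauForm (n + 1) L p =
      girardeauForm₂ (n + 1) L (fun x => φ x - p x) φ +
        girardeauForm₂ (n + 1) L p (fun x => φ x - p x) := by
    rw [girardeauForm₂_sub_left hL n hφ hp hφ, girardeauForm₂_sub_right hL n hp hφ hp,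
      ← girardeauForm₂_self, ← girardeauForm₂_self]
    ring
  rw [key]
  have hD := densityBound_nonneg hL n
  calc ‖girardeauForm₂ (n + 1) L (fun x => φ x - p x) φ +
        girardeauForm₂ (n + 1) L p (fun x => φ x - p x)‖
      ≤ ‖girardeauForm₂ (n + 1) L (fun x => φ x - p x) φ‖ +
        ‖girardeauForm₂ (n + 1) L p (fun x => φ x - p x)‖ := norm_add_le _ _
    _ ≤ densityBound n L * (∫ x in Set.Icc 0 L, ‖φ x - p x‖) * (∫ x in Set.Icc 0 L, ‖φ x‖) +
        densityBound n L * (∫ x in Set.Icc 0 L, ‖p x‖) * (∫ x in Set.Icc 0 L, ‖φ x - p x‖) :=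
        add_le_add (norm_girardeauForm₂_le hL n hd hφ) (norm_girardeauForm₂_le hL n hp hd)
    _ = _ := by ring


/-! ### Plane waves diagonalise the form -/

/-- For every `x`: `∫₀ᴸ conj e_m(x) ρ_{n+1}(x, y) e_m(y) dy = c_m(n+1)` — the integrand depends on
`x − y` only (Lenard's formula), so the `y`-integral over a period does not depend on `x`, and its
`x`-average is `L⁻¹⟨e_m, γ e_m⟩ = c_m`. [cite: ForresterEtAl2003, §2.2.1] -/
theorem integral_conj_ez_density_ez (hL : 0 < L) (n : ℕ) (m : ℤ) (x : ℝ) :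
    ∫ y in Set.Icc 0 L, conj (ez L m x) * (girardeauDensityMatrix (n + 1) L x y : ℂ) * ez L m y =
      (momentumOccupation (n + 1) L m : ℂ) := by
  -- the inner integral of `girardeauForm_ez`, verbatim
  set G : ℝ → ℂ := fun u => modeKernel n m (2 * π * u / L) with hG
  have hper : Function.Periodic G L := by
    intro u
    simp only [hG]
    rw [show 2 * π * (u + L) / L = 2 * π * u / L + 2 * π by field_simp]
    exact modeKernel_periodic n m _
  have hc : (2 * π / L : ℝ) ≠ 0 := by positivity
  have hscale : ∫ u in (0 : ℝ)..L, G u =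
      ((L / (2 * π) : ℝ) : ℂ) * ∫ t in (0 : ℝ)..2 * π, modeKernel n m t := by
    have h := intervalIntegral.integral_comp_mul_left (a := 0) (b := L) (modeKernel n m) hc
    rw [mul_zero, show 2 * π / L * L = 2 * π by field_simp, Complex.real_smul] at h
    rw [show G = fun u => modeKernel n m (2 * π / L * u) from
      funext fun u => by simp only [hG]; ring_nf, h]
    congr 1
    push_cast
    field_simp
  have hinner :
      ∫ y in Set.Icc 0 L, conj (ez L m x) * (girardeauDensityMatrix (n + 1) L x y : ℂ) * ez L m y =
        ((L⁻¹ : ℝ) : ℂ) * (((L / (2 * π) : ℝ) : ℂ) * ∫ t in (0 : ℝ)..2 * π, modeKernel n m t) := by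
    simp_rw [girardeauIntegrand_ez hL]
    rw [integral_Icc_eq_integral_Ioc, ← intervalIntegral.integral_of_le hL.le,
      intervalIntegral.integral_const_mul]
    congr 1
    have h1 : ∫ y in (0 : ℝ)..L, modeKernel n m (2 * π * (x - y) / L) =
        ∫ u in x - L..x - 0, G u :=
      intervalIntegral.integral_comp_sub_left G x
    rw [h1, sub_zero]
    have h2 := hper.intervalIntegral_add_eq (x - L) 0
    rw [show x - L + L = x by ring, zero_add] at h2
    rw [h2, hscale]
  rw [hinner, ← girardeauForm_ez hL n m]
  -- `L⁻¹ ⟨e_m, γ e_m⟩ = c_m` as complex numbers (the form is real)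
  have hre := girardeauForm_eq_re (n + 1) L ((continuous_ez L m).integrableOn_Icc)
  rw [hre]
  unfold momentumOccupation
  push_cast
  ring

/-- **The plane waves are eigenfunctions of `γ_N`**: `(γ_N e_m)(x) = c_m(N) e_m(x)` for every
`x` ("the natural orbitals on the circle are the plane waves").
[cite: ForresterEtAl2003, §3.1.3] -/
theorem densityApply_ez (hL : 0 < L) (n : ℕ) (m : ℤ) (x : ℝ) :
    densityApply (n + 1) L (ez L m) x = (momentumOccupation (n + 1) L m : ℂ) * ez L m x := by
  have h := integral_conj_ez_density_ez hL n m x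
  have hunit : ez L m x * conj (ez L m x) = 1 := by
    rw [mul_conj_eq_norm_sq, norm_ez]; simp
  have h1 : densityApply (n + 1) L (ez L m) x =
      ez L m x * ∫ y in Set.Icc 0 L,
        conj (ez L m x) * (girardeauDensityMatrix (n + 1) L x y : ℂ) * ez L m y := by
    unfold densityApply
    rw [← integral_const_mul]
    refine integral_congr_ae (Filter.Eventually.of_forall fun y => ?_)
    simp only
    calc (girardeauDensityMatrix (n + 1) L x y : ℂ) * ez L m y
        = (ez L m x * conj (ez L m x)) * ((girardeauDensityMatrix (n + 1) L x y : ℂ) * ez L m y) := by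
          rw [hunit, one_mul]
      _ = _ := by ring
  rw [h1, h, mul_comm]

/-- **Matrix elements of `γ_N` in the plane waves**: `⟨e_m, γ_N e_{m'}⟩ = L c_m(N) δ_{mm'}` —
`γ_N` is DIAGONAL in the momentum basis (translation invariance on the ring).
[cite: ForresterEtAl2003, §3.1.3] -/
theorem girardeauForm₂_ez_ez (hL : 0 < L) (n : ℕ) (m m' : ℤ) :
    girardeauForm₂ (n + 1) L (ez L m) (ez L m') =
      if m = m' then ((L * momentumOccupation (n + 1) L m : ℝ) : ℂ) else 0 := by
  rw [girardeauForm₂_eq_integral_densityApply]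
  simp_rw [densityApply_ez hL n m']
  have hpt : ∀ x, conj (ez L m x) * ((momentumOccupation (n + 1) L m' : ℂ) * ez L m' x) =
      (momentumOccupation (n + 1) L m' : ℂ) * ez L (m' - m) x := by
    intro x
    rw [← ez_mul_conj_ez]
    ring
  simp_rw [hpt, integral_const_mul, integral_ez_Icc hL, sub_eq_zero]
  by_cases h : m = m'
  · subst h
    simp only [if_true]
    push_cast
    ring
  · rw [if_neg (Ne.symm h), if_neg h, mul_zero]

/-! ### Trigonometric polynomials in the form -/

/-- `γ_N` on a trigonometric polynomial: `γ_N(∑ b_m e_m) = ∑ b_m c_m e_m`. [folklore] -/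
theorem densityApply_sum_ez (hL : 0 < L) (n : ℕ) (K : Finset ℤ) (b : ℤ → ℂ) (x : ℝ) :
    densityApply (n + 1) L (fun y => ∑ m ∈ K, b m * ez L m y) x =
      ∑ m ∈ K, b m * (momentumOccupation (n + 1) L m : ℂ) * ez L m x := by
  have hint : ∀ m ∈ K, IntegrableOn
      (fun y => (girardeauDensityMatrix (n + 1) L x y : ℂ) * (b m * ez L m y)) (Set.Icc 0 L) :=
    fun m _ => integrableOn_density_mul hL n
      ((continuous_const.mul (continuous_ez L m)).integrableOn_Icc) x
  calc densityApply (n + 1) L (fun y => ∑ m ∈ K, b m * ez L m y) x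
      = ∫ y in Set.Icc 0 L, ∑ m ∈ K,
          (girardeauDensityMatrix (n + 1) L x y : ℂ) * (b m * ez L m y) := by
        unfold densityApply
        refine integral_congr_ae (Filter.Eventually.of_forall fun y => ?_)
        simp only [Finset.mul_sum]
    _ = ∑ m ∈ K, ∫ y in Set.Icc 0 L,
          (girardeauDensityMatrix (n + 1) L x y : ℂ) * (b m * ez L m y) :=
        integral_finsetSum K hint
    _ = ∑ m ∈ K, b m * densityApply (n + 1) L (ez L m) x := by
        refine Finset.sum_congr rfl fun m _ => ?_
        unfold densityApply
        rw [← integral_const_mul]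
        refine integral_congr_ae (Filter.Eventually.of_forall fun y => ?_)
        simp only
        ring
    _ = _ := by
        refine Finset.sum_congr rfl fun m _ => ?_
        rw [densityApply_ez hL n m x, mul_assoc]

/-- **The form on trigonometric polynomials**:
`⟨∑ a_m e_m, γ_N ∑ b_m e_m⟩ = L ∑_m conj(a_m) b_m c_m(N)`. [cite: ForresterEtAl2003, §2.2.1] -/
theorem girardeauForm₂_sum_ez (hL : 0 < L) (n : ℕ) (K : Finset ℤ) (a b : ℤ → ℂ) :
    girardeauForm₂ (n + 1) L (fun x => ∑ m ∈ K, a m * ez L m x) (fun y => ∑ m ∈ K, b m * ez L m y) =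
      ∑ m ∈ K, conj (a m) * b m * ((L * momentumOccupation (n + 1) L m : ℝ) : ℂ) := by
  rw [girardeauForm₂_eq_integral_densityApply]
  simp_rw [densityApply_sum_ez hL n K b]
  set c : ℤ → ℂ := fun m => (momentumOccupation (n + 1) L m : ℂ) with hc
  have hpt : ∀ x, conj (∑ m ∈ K, a m * ez L m x) * ∑ m' ∈ K, b m' * c m' * ez L m' x =
      ∑ m ∈ K, ∑ m' ∈ K, (conj (a m) * b m' * c m') * ez L (m' - m) x := by
    intro x
    rw [map_sum, Finset.sum_mul]
    refine Finset.sum_congr rfl fun m _ => ?_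
    rw [Finset.mul_sum]
    refine Finset.sum_congr rfl fun m' _ => ?_
    rw [map_mul, ← ez_mul_conj_ez]
    ring
  have hint : ∀ m m' : ℤ, IntegrableOn (fun x => (conj (a m) * b m' * c m') * ez L (m' - m) x)
      (Set.Icc 0 L) := fun m m' =>
    (continuous_const.mul (continuous_ez L _)).integrableOn_Icc
  simp_rw [show ∀ x, (∑ m' ∈ K, b m' * (momentumOccupation (n + 1) L m' : ℂ) * ez L m' x) =
      ∑ m' ∈ K, b m' * c m' * ez L m' x from fun x => rfl]
  simp_rw [hpt]
  rw [integral_finsetSum _ fun m _ => integrable_finsetSum _ fun m' _ => hint m m']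
  simp_rw [integral_finsetSum _ fun m' _ => hint _ m', integral_const_mul, integral_ez_Icc hL,
    sub_eq_zero, mul_ite, mul_zero]
  refine Finset.sum_congr rfl fun m hm => ?_
  rw [Finset.sum_ite_eq' K m, if_pos hm]
  simp only [hc]
  push_cast
  ring

/-! ### Fourier partial sums of a mode -/

/-- The Fourier partial sum `S_K φ = ∑_{m∈K} φ̂(m) e_m`, `φ̂(m) = L⁻¹∫₀ᴸ conj(e_m) φ`
(`ezCoeff`). [folklore] -/
def fourierPartial (L : ℝ) (K : Finset ℤ) (φ : ℝ → ℂ) (x : ℝ) : ℂ :=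
  ∑ m ∈ K, ezCoeff L φ m * ez L m x

/-- `S_K φ` is continuous. [folklore] -/
theorem continuous_fourierPartial (L : ℝ) (K : Finset ℤ) (φ : ℝ → ℂ) :
    Continuous (fourierPartial L K φ) :=
  continuous_finsetSum _ fun m _ => continuous_const.mul (continuous_ez L m)

/-- `S_K φ ∈ L¹[0, L]`. [folklore] -/
theorem integrableOn_fourierPartial (L : ℝ) (K : Finset ℤ) (φ : ℝ → ℂ) :
    IntegrableOn (fourierPartial L K φ) (Set.Icc 0 L) :=
  (continuous_fourierPartial L K φ).integrableOn_Icc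

/-- **The form on a Fourier partial sum**: `⟨S_K φ, γ_N S_K φ⟩ = L ∑_{m∈K} c_m(N) |φ̂(m)|²`.
[cite: ForresterEtAl2003, §2.2.1] -/
theorem girardeauForm_fourierPartial (hL : 0 < L) (n : ℕ) (K : Finset ℤ) (φ : ℝ → ℂ) :
    girardeauForm (n + 1) L (fourierPartial L K φ) =
      ((L * ∑ m ∈ K, momentumOccupation (n + 1) L m * ‖ezCoeff L φ m‖ ^ 2 : ℝ) : ℂ) := by
  rw [← girardeauForm₂_self]
  unfold fourierPartial
  rw [girardeauForm₂_sum_ez hL n K]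
  push_cast
  rw [Finset.mul_sum]
  refine Finset.sum_congr rfl fun m _ => ?_
  rw [mul_comm (conj (ezCoeff L φ m)) (ezCoeff L φ m), mul_conj_eq_norm_sq]
  push_cast
  ring


/-! ### Square-integrable modes: Parseval and Pythagoras on `[0, L]` -/

section L2

variable {φ : ℝ → ℂ}

/-- An `L²[0, L]` mode is in `L¹[0, L]`. [folklore] -/
theorem integrableOn_of_memLp_two (hφ : MemLp φ 2 (volume.restrict (Set.Icc (0 : ℝ) L))) :
    IntegrableOn φ (Set.Icc 0 L) :=
  hφ.integrable one_le_two

/-- `|φ|²` is integrable for an `L²` mode. [folklore] -/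
theorem integrableOn_norm_sq_of_memLp_two (hφ : MemLp φ 2 (volume.restrict (Set.Icc (0 : ℝ) L))) :
    IntegrableOn (fun x => ‖φ x‖ ^ 2) (Set.Icc 0 L) :=
  (memLp_two_iff_integrable_sq_norm hφ.1).1 hφ

/-- `L φ̂(m) = ∫₀ᴸ conj(e_m) φ`. [folklore] -/
theorem mul_ezCoeff (hL : 0 < L) (φ : ℝ → ℂ) (m : ℤ) :
    (L : ℂ) * ezCoeff L φ m = ∫ x in Set.Icc 0 L, conj (ez L m x) * φ x := by
  unfold ezCoeff
  rw [← mul_assoc, mul_inv_cancel₀ (by exact_mod_cast hL.ne'), one_mul]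

/-- `∫₀ᴸ conj(S_K φ) φ = L ∑_{m∈K} |φ̂(m)|²`. [folklore] -/
theorem integral_conj_fourierPartial_mul (hL : 0 < L) (K : Finset ℤ)
    (hφ : IntegrableOn φ (Set.Icc 0 L)) :
    ∫ x in Set.Icc 0 L, conj (fourierPartial L K φ x) * φ x =
      ((L * ∑ m ∈ K, ‖ezCoeff L φ m‖ ^ 2 : ℝ) : ℂ) := by
  unfold fourierPartial
  have hint : ∀ m ∈ K, IntegrableOn (fun x => conj (ezCoeff L φ m) * (conj (ez L m x) * φ x))
      (Set.Icc 0 L) := by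
    intro m _
    refine (Integrable.bdd_mul (c := 1) hφ ?_ (Filter.Eventually.of_forall fun x => ?_)).const_mul _
    · exact (Complex.continuous_conj.comp (continuous_ez L m)).aestronglyMeasurable
    · rw [Complex.norm_conj, norm_ez]
  have hpt : ∀ x, conj (∑ m ∈ K, ezCoeff L φ m * ez L m x) * φ x =
      ∑ m ∈ K, conj (ezCoeff L φ m) * (conj (ez L m x) * φ x) := by
    intro x
    rw [map_sum, Finset.sum_mul]
    refine Finset.sum_congr rfl fun m _ => ?_
    rw [map_mul]
    ring
  simp_rw [hpt]
  rw [integral_finsetSum K hint]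
  simp_rw [integral_const_mul, ← mul_ezCoeff hL φ]
  push_cast
  rw [Finset.mul_sum]
  refine Finset.sum_congr rfl fun m _ => ?_
  rw [mul_comm (conj (ezCoeff L φ m)), mul_assoc, mul_conj_eq_norm_sq]
  push_cast
  ring

/-- **Pythagoras for the Fourier partial sums**: for `φ ∈ L²[0, L]`,
`∫₀ᴸ |φ − S_K φ|² = ∫₀ᴸ |φ|² − L ∑_{m∈K} |φ̂(m)|²`. [folklore] -/
theorem integral_norm_sq_sub_fourierPartial (hL : 0 < L)
    (hφ : MemLp φ 2 (volume.restrict (Set.Icc (0 : ℝ) L))) (K : Finset ℤ) :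
    ∫ x in Set.Icc 0 L, ‖φ x - fourierPartial L K φ x‖ ^ 2 =
      (∫ x in Set.Icc 0 L, ‖φ x‖ ^ 2) - L * ∑ m ∈ K, ‖ezCoeff L φ m‖ ^ 2 := by
  set g : ℝ → ℂ := fourierPartial L K φ with hg
  set B : ℝ := ∑ m ∈ K, ‖ezCoeff L φ m‖ ^ 2 with hB
  have hφ1 : IntegrableOn φ (Set.Icc 0 L) := integrableOn_of_memLp_two hφ
  have hφ2 : IntegrableOn (fun x => ‖φ x‖ ^ 2) (Set.Icc 0 L) := integrableOn_norm_sq_of_memLp_two hφ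
  have hgc : Continuous g := continuous_fourierPartial L K φ
  have hgb : ∀ x, ‖g x‖ ≤ ∑ m ∈ K, ‖ezCoeff L φ m‖ := fun x => norm_sum_ez_le L K _ x
  -- the four pieces of `|φ − g|² = conj φ φ − conj g φ − conj φ g + conj g g`
  have h1 : ∫ x in Set.Icc 0 L, conj (g x) * φ x = ((L * B : ℝ) : ℂ) :=
    integral_conj_fourierPartial_mul hL K hφ1
  have hI1 : IntegrableOn (fun x => conj (g x) * φ x) (Set.Icc 0 L) :=
    Integrable.bdd_mul hφ1 (Complex.continuous_conj.comp hgc).aestronglyMeasurable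
      (Filter.Eventually.of_forall fun x => by rw [Complex.norm_conj]; exact hgb x)
  have h2 : ∫ x in Set.Icc 0 L, conj (φ x) * g x = ((L * B : ℝ) : ℂ) := by
    have : (fun x => conj (φ x) * g x) = fun x => conj (conj (g x) * φ x) := by
      funext x
      rw [map_mul, Complex.conj_conj, mul_comm]
    rw [this, integral_conj, h1, Complex.conj_ofReal]
  have hI2 : IntegrableOn (fun x => conj (φ x) * g x) (Set.Icc 0 L) :=
    Integrable.mul_bdd (integrableOn_conj hφ1) hgc.aestronglyMeasurable
      (Filter.Eventually.of_forall fun x => hgb x)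
  have h3 : ∫ x in Set.Icc 0 L, conj (g x) * g x = ((L * B : ℝ) : ℂ) := by
    have h := integral_norm_sq_sum_ez hL K (ezCoeff L φ)
    have : (fun x => conj (g x) * g x) = fun x => ((‖g x‖ ^ 2 : ℝ) : ℂ) := by
      funext x
      rw [mul_comm, mul_conj_eq_norm_sq]
    rw [this, integral_complex_ofReal]
    exact_mod_cast h
  have hI3 : IntegrableOn (fun x => conj (g x) * g x) (Set.Icc 0 L) :=
    ((Complex.continuous_conj.comp hgc).mul hgc).integrableOn_Icc
  have h4 : ∫ x in Set.Icc 0 L, conj (φ x) * φ x = ((∫ x in Set.Icc 0 L, ‖φ x‖ ^ 2 : ℝ) : ℂ) := by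
    rw [← integral_complex_ofReal]
    refine integral_congr_ae (Filter.Eventually.of_forall fun x => ?_)
    simp only
    rw [mul_comm, mul_conj_eq_norm_sq]
  have hI4 : IntegrableOn (fun x => conj (φ x) * φ x) (Set.Icc 0 L) := by
    have : (fun x => conj (φ x) * φ x) = fun x => ((‖φ x‖ ^ 2 : ℝ) : ℂ) := by
      funext x; rw [mul_comm, mul_conj_eq_norm_sq]
    rw [this]
    exact hφ2.ofReal
  -- assemble
  have hpt : ∀ x, ((‖φ x - g x‖ ^ 2 : ℝ) : ℂ) =
      conj (φ x) * φ x - conj (g x) * φ x - (conj (φ x) * g x - conj (g x) * g x) := by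
    intro x
    rw [← mul_conj_eq_norm_sq, map_sub]
    ring
  have hC : ((∫ x in Set.Icc 0 L, ‖φ x - g x‖ ^ 2 : ℝ) : ℂ) =
      (((∫ x in Set.Icc 0 L, ‖φ x‖ ^ 2) - L * B : ℝ) : ℂ) := by
    rw [← integral_complex_ofReal]
    simp_rw [hpt]
    have hA : IntegrableOn (fun x => conj (φ x) * φ x - conj (g x) * φ x) (Set.Icc 0 L) :=
      hI4.sub hI1
    have hB' : IntegrableOn (fun x => conj (φ x) * g x - conj (g x) * g x) (Set.Icc 0 L) :=
      hI2.sub hI3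
    rw [integral_sub hA hB', integral_sub hI4 hI1, integral_sub hI2 hI3, h1, h2, h3, h4]
    push_cast
    ring
  exact_mod_cast hC

/-- **Bessel's inequality for an `L²` mode**: `L ∑_{m∈K} |φ̂(m)|² ≤ ∫₀ᴸ |φ|²`. [folklore] -/
theorem mul_sum_sq_ezCoeff_le (hL : 0 < L) (hφ : MemLp φ 2 (volume.restrict (Set.Icc (0 : ℝ) L)))
    (K : Finset ℤ) :
    L * ∑ m ∈ K, ‖ezCoeff L φ m‖ ^ 2 ≤ ∫ x in Set.Icc 0 L, ‖φ x‖ ^ 2 := by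
  have h := integral_norm_sq_sub_fourierPartial hL hφ K
  have h0 : 0 ≤ ∫ x in Set.Icc 0 L, ‖φ x - fourierPartial L K φ x‖ ^ 2 :=
    integral_nonneg fun _ => by positivity
  linarith

/-- **Parseval on `[0, L]`** in the plane-wave normalisation of this file: for `φ ∈ L²[0, L]`,
`∑_{m∈ℤ} |φ̂(m)|² = L⁻¹ ∫₀ᴸ |φ|²` (Mathlib's `hasSum_sq_fourierCoeffOn`). [folklore] -/
theorem hasSum_sq_ezCoeff (hL : 0 < L) (hφ : MemLp φ 2 (volume.restrict (Set.Icc (0 : ℝ) L))) :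
    HasSum (fun m : ℤ => ‖ezCoeff L φ m‖ ^ 2) (L⁻¹ * ∫ x in Set.Icc 0 L, ‖φ x‖ ^ 2) := by
  have hφ' : MemLp φ 2 (volume.restrict (Set.Ioc (0 : ℝ) L)) :=
    hφ.mono_measure (Measure.restrict_mono Set.Ioc_subset_Icc_self le_rfl)
  have h := hasSum_sq_fourierCoeffOn hL hφ'
  have hcoef : ∀ i : ℤ, fourierCoeffOn hL φ i = ezCoeff L φ i := by
    intro i
    rw [fourierCoeffOn_eq_integral, intervalIntegral.integral_of_le hL.le,
      ← integral_Icc_eq_integral_Ioc]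
    have hint : ∫ y in Set.Icc 0 L, fourier (-i) (y : AddCircle (L - 0)) • φ y =
        ∫ y in Set.Icc 0 L, conj (ez L i y) * φ y := by
      refine integral_congr_ae (Filter.Eventually.of_forall fun y => ?_)
      simp only
      rw [fourier_neg_coe_smul, sub_zero, conj_ez, mul_comm]
    rw [hint, sub_zero]
    unfold ezCoeff
    rw [Complex.real_smul]
    push_cast
    ring
  have hrhs : (L - 0)⁻¹ • ∫ x in (0 : ℝ)..L, ‖φ x‖ ^ 2 = L⁻¹ * ∫ x in Set.Icc 0 L, ‖φ x‖ ^ 2 := by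
    rw [sub_zero, smul_eq_mul, intervalIntegral.integral_of_le hL.le, ← integral_Icc_eq_integral_Ioc]
  rw [hrhs] at h
  simp_rw [hcoef] at h
  exact h

/-- **`S_K φ → φ` in `L²[0, L]`** along the finite sets `K ↑ ℤ`. [folklore] -/
theorem tendsto_integral_norm_sq_sub_fourierPartial (hL : 0 < L)
    (hφ : MemLp φ 2 (volume.restrict (Set.Icc (0 : ℝ) L))) :
    Tendsto (fun K : Finset ℤ => ∫ x in Set.Icc 0 L, ‖φ x - fourierPartial L K φ x‖ ^ 2)
      atTop (𝓝 0) := by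
  have h := (hasSum_sq_ezCoeff hL hφ).mul_left L
  rw [← mul_assoc, mul_inv_cancel₀ hL.ne', one_mul] at h
  have h2 : Tendsto (fun K : Finset ℤ => L * ∑ m ∈ K, ‖ezCoeff L φ m‖ ^ 2) atTop
      (𝓝 (∫ x in Set.Icc 0 L, ‖φ x‖ ^ 2)) := by
    have h' := h
    rw [HasSum] at h'
    refine h'.congr fun K => ?_
    rw [Finset.mul_sum]
  have h3 := (tendsto_const_nhds (x := ∫ x in Set.Icc 0 L, ‖φ x‖ ^ 2)).sub h2
  rw [sub_self] at h3
  refine h3.congr fun K => ?_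
  rw [integral_norm_sq_sub_fourierPartial hL hφ K]

/-- `‖v‖ ≤ t/2 + ‖v‖²/(2t)` for `t > 0`. [folklore] -/
theorem norm_le_half_add_sq_div (v : ℂ) {t : ℝ} (ht : 0 < t) :
    ‖v‖ ≤ t / 2 + ‖v‖ ^ 2 / (2 * t) := by
  have h : 0 ≤ (‖v‖ - t) ^ 2 := sq_nonneg _
  rw [div_add_div _ _ two_ne_zero (by positivity), le_div_iff₀ (by positivity)]
  nlinarith [norm_nonneg v]

/-- `S_K φ ∈ L²[0, L]`. [folklore] -/
theorem memLp_fourierPartial (L : ℝ) (K : Finset ℤ) (φ : ℝ → ℂ) :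
    MemLp (fourierPartial L K φ) 2 (volume.restrict (Set.Icc (0 : ℝ) L)) :=
  MemLp.of_bound (continuous_fourierPartial L K φ).aestronglyMeasurable _
    (Filter.Eventually.of_forall fun x => norm_sum_ez_le L K _ x)

/-- **`S_K φ → φ` in `L¹[0, L]`** (from the `L²` convergence on a finite interval). [folklore] -/
theorem tendsto_integral_norm_sub_fourierPartial (hL : 0 < L)
    (hφ : MemLp φ 2 (volume.restrict (Set.Icc (0 : ℝ) L))) :
    Tendsto (fun K : Finset ℤ => ∫ x in Set.Icc 0 L, ‖φ x - fourierPartial L K φ x‖)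
      atTop (𝓝 0) := by
  rw [Metric.tendsto_atTop]
  intro ε hε
  set t : ℝ := ε / L with ht
  have htpos : 0 < t := by positivity
  obtain ⟨K₀, hK₀⟩ := Metric.tendsto_atTop.1 (tendsto_integral_norm_sq_sub_fourierPartial hL hφ)
    (ε * t) (by positivity)
  refine ⟨K₀, fun K hK => ?_⟩
  have hI := hK₀ K hK
  rw [Real.dist_eq, sub_zero] at hI ⊢
  set d : ℝ → ℂ := fun x => φ x - fourierPartial L K φ x with hd
  have hdm : MemLp d 2 (volume.restrict (Set.Icc (0 : ℝ) L)) := hφ.sub (memLp_fourierPartial L K φ)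
  have hd1 : IntegrableOn (fun x => ‖d x‖) (Set.Icc 0 L) := (integrableOn_of_memLp_two hdm).norm
  have hd2 : IntegrableOn (fun x => ‖d x‖ ^ 2) (Set.Icc 0 L) := integrableOn_norm_sq_of_memLp_two hdm
  have hsq : ∫ x in Set.Icc 0 L, ‖d x‖ ^ 2 < ε * t := by
    have := hI
    rw [abs_of_nonneg (integral_nonneg fun _ => by positivity)] at this
    exact this
  have hle : ∫ x in Set.Icc 0 L, ‖d x‖ ≤ L * (t / 2) + (∫ x in Set.Icc 0 L, ‖d x‖ ^ 2) / (2 * t) := by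
    calc ∫ x in Set.Icc 0 L, ‖d x‖
        ≤ ∫ x in Set.Icc 0 L, (t / 2 + ‖d x‖ ^ 2 / (2 * t)) :=
          integral_mono hd1 ((integrable_const _).add (hd2.div_const _))
            fun x => norm_le_half_add_sq_div (d x) htpos
      _ = L * (t / 2) + (∫ x in Set.Icc 0 L, ‖d x‖ ^ 2) / (2 * t) := by
          rw [integral_add (integrable_const _) (hd2.div_const _), setIntegral_Icc_const hL.le,
            integral_div]
  rw [abs_of_nonneg (integral_nonneg fun _ => norm_nonneg _)]
  have h1 : L * (t / 2) = ε / 2 := by rw [ht]; field_simp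
  have h2 : (∫ x in Set.Icc 0 L, ‖d x‖ ^ 2) / (2 * t) < ε / 2 := by
    rw [div_lt_iff₀ (by positivity)]
    calc ∫ x in Set.Icc 0 L, ‖d x‖ ^ 2 < ε * t := hsq
      _ = ε / 2 * (2 * t) := by ring
  calc ∫ x in Set.Icc 0 L, ‖d x‖ ≤ L * (t / 2) + (∫ x in Set.Icc 0 L, ‖d x‖ ^ 2) / (2 * t) := hle
    _ < ε / 2 + ε / 2 := by rw [h1]; linarith
    _ = ε := by ring

/-- **Continuity of the occupation form along the Fourier partial sums**:
`⟨S_K φ, γ_N S_K φ⟩ → ⟨φ, γ_N φ⟩`. [folklore] -/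
theorem tendsto_girardeauForm_fourierPartial (hL : 0 < L) (n : ℕ)
    (hφ : MemLp φ 2 (volume.restrict (Set.Icc (0 : ℝ) L))) :
    Tendsto (fun K : Finset ℤ => girardeauForm (n + 1) L (fourierPartial L K φ)) atTop
      (𝓝 (girardeauForm (n + 1) L φ)) := by
  have hφ1 : IntegrableOn φ (Set.Icc 0 L) := integrableOn_of_memLp_two hφ
  set A : ℝ := ∫ x in Set.Icc 0 L, ‖φ x‖ with hA
  set δ : Finset ℤ → ℝ := fun K => ∫ x in Set.Icc 0 L, ‖φ x - fourierPartial L K φ x‖ with hδ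
  have hδt : Tendsto δ atTop (𝓝 0) := tendsto_integral_norm_sub_fourierPartial hL hφ
  rw [tendsto_iff_norm_sub_tendsto_zero]
  have hbound : ∀ K, ‖girardeauForm (n + 1) L (fourierPartial L K φ) - girardeauForm (n + 1) L φ‖ ≤
      densityBound n L * δ K * (2 * A + δ K) := by
    intro K
    rw [norm_sub_rev]
    have hp1 := integrableOn_fourierPartial L K φ
    have h := norm_girardeauForm_sub_le hL n hφ1 hp1
    have hd1 : IntegrableOn (fun x => φ x - fourierPartial L K φ x) (Set.Icc 0 L) := hφ1.sub hp1
    have hS : ∫ x in Set.Icc 0 L, ‖fourierPartial L K φ x‖ ≤ A + δ K := by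
      show ∫ x in Set.Icc 0 L, ‖fourierPartial L K φ x‖ ≤
        (∫ x in Set.Icc 0 L, ‖φ x‖) + ∫ x in Set.Icc 0 L, ‖φ x - fourierPartial L K φ x‖
      rw [← integral_add hφ1.norm hd1.norm]
      refine integral_mono hp1.norm (hφ1.norm.add hd1.norm) fun x => ?_
      have := norm_sub_le (φ x) (φ x - fourierPartial L K φ x)
      rw [sub_sub_cancel] at this
      simp only
      linarith
    have hD := densityBound_nonneg hL n
    have hδ0 : 0 ≤ δ K := integral_nonneg fun _ => norm_nonneg _
    calc ‖girardeauForm (n + 1) L φ - girardeauForm (n + 1) L (fourierPartial L K φ)‖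
        ≤ densityBound n L * δ K * (A + ∫ x in Set.Icc 0 L, ‖fourierPartial L K φ x‖) := h
      _ ≤ densityBound n L * δ K * (A + (A + δ K)) :=
          mul_le_mul_of_nonneg_left (by linarith) (mul_nonneg hD hδ0)
      _ = densityBound n L * δ K * (2 * A + δ K) := by ring
  refine squeeze_zero (fun K => norm_nonneg _) hbound ?_
  have h := (tendsto_const_nhds (x := densityBound n L)).mul hδt
  have h2 := h.mul ((tendsto_const_nhds (x := 2 * A)).add hδt)
  rw [mul_zero, add_zero, zero_mul] at h2
  exact h2

/-- **Plane waves diagonalise `γ_N` (the natural orbitals on the ring are the plane waves).**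
For every `L > 0`, every `N ≥ 1` and every `φ ∈ L²[0, L]`,
`⟨φ, γ_N φ⟩ = ∑_{m∈ℤ} c_m(N) · L|φ̂(m)|² = ∑_m c_m(N) |⟨e_m/√L, φ⟩|²` as an unconditional sum:
the quadratic form of the one-body density matrix is diagonal in the momentum basis with
eigenvalues the occupations `c_m(N)` — the prose statement "the natural orbitals are plane waves"
of [cite: ForresterEtAl2003, §3.1.3] for the periodic ring, typed. [cite: ForresterEtAl2003, §2.2.1] -/
theorem hasSum_momentumOccupation_mul_sq_ezCoeff (hL : 0 < L) (n : ℕ)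
    (hφ : MemLp φ 2 (volume.restrict (Set.Icc (0 : ℝ) L))) :
    HasSum (fun m : ℤ => L * (momentumOccupation (n + 1) L m * ‖ezCoeff L φ m‖ ^ 2))
      ((girardeauForm (n + 1) L φ).re) := by
  have h := tendsto_girardeauForm_fourierPartial hL n hφ
  have h2 := (Complex.continuous_re.tendsto _).comp h
  rw [HasSum]
  refine h2.congr fun K => ?_
  simp only [Function.comp_apply]
  rw [girardeauForm_fourierPartial hL n K φ, Complex.ofReal_re, Finset.mul_sum]

/-- The partial sums converge: `L ∑_{m∈K} c_m(N)|φ̂(m)|² → ⟨φ, γ_N φ⟩` as `K ↑ ℤ`. [folklore] -/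
theorem tendsto_sum_momentumOccupation_mul_sq (hL : 0 < L) (n : ℕ)
    (hφ : MemLp φ 2 (volume.restrict (Set.Icc (0 : ℝ) L))) :
    Tendsto (fun K : Finset ℤ => L * ∑ m ∈ K, momentumOccupation (n + 1) L m * ‖ezCoeff L φ m‖ ^ 2)
      atTop (𝓝 ((girardeauForm (n + 1) L φ).re)) := by
  have h := hasSum_momentumOccupation_mul_sq_ezCoeff hL n hφ
  rw [HasSum] at h
  refine h.congr fun K => ?_
  rw [Finset.mul_sum]

end L2


/-! ### Orthonormal families of modes: Bessel across the family -/

section Family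

variable {M : ℕ}

/-- Conjugation preserves `L²`. [folklore] -/
theorem memLp_two_conj {φ : ℝ → ℂ} (hφ : MemLp φ 2 (volume.restrict (Set.Icc (0 : ℝ) L))) :
    MemLp (fun x => conj (φ x)) 2 (volume.restrict (Set.Icc (0 : ℝ) L)) :=
  hφ.of_le (Complex.continuous_conj.comp_aestronglyMeasurable hφ.1)
    (Filter.Eventually.of_forall fun x => by rw [Complex.norm_conj])

/-- `conj φ · ψ ∈ L¹[0, L]` for `φ, ψ ∈ L²[0, L]` (Hölder `2, 2`). [folklore] -/
theorem integrableOn_conj_mul {φ ψ : ℝ → ℂ} (hφ : MemLp φ 2 (volume.restrict (Set.Icc (0 : ℝ) L)))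
    (hψ : MemLp ψ 2 (volume.restrict (Set.Icc (0 : ℝ) L))) :
    IntegrableOn (fun x => conj (φ x) * ψ x) (Set.Icc 0 L) := by
  have h : MemLp (fun x => conj (φ x) * ψ x) 1 (volume.restrict (Set.Icc (0 : ℝ) L)) :=
    MemLp.mul' (p := 2) (q := 2) (r := 1) hψ (memLp_two_conj hφ)
  exact memLp_one_iff_integrable.1 h

/-- A normalised mode has `∫₀ᴸ |φ|² = 1`. [folklore] -/
theorem integral_norm_sq_eq_one_of_orth {φ : ℝ → ℂ}
    (h : ∫ x in Set.Icc 0 L, conj (φ x) * φ x = 1) :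
    ∫ x in Set.Icc 0 L, ‖φ x‖ ^ 2 = 1 := by
  have h1 : ((∫ x in Set.Icc 0 L, ‖φ x‖ ^ 2 : ℝ) : ℂ) = 1 := by
    rw [← integral_complex_ofReal, ← h]
    refine integral_congr_ae (Filter.Eventually.of_forall fun x => ?_)
    simp only
    rw [mul_comm, mul_conj_eq_norm_sq]
  exact_mod_cast h1

/-- **Bessel's inequality across an orthonormal family.** For orthonormal `φ₀, …, φ_{M−1}` in
`L²[0, L]` and every plane wave `e_m`: `∑_i |⟨φ_i, e_m⟩|² ≤ ‖e_m‖² = L`, i.e. in the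
normalisation `φ̂(m) = L⁻¹∫ conj(e_m) φ` of this file, `L ∑_i |φ̂_i(m)|² ≤ 1`
(`0 ≤ ∫|e_m − ∑_i ⟨φ_i, e_m⟩ φ_i|² = L − ∑_i |⟨φ_i, e_m⟩|²`). [folklore] -/
theorem mul_sum_sq_ezCoeff_family_le_one (hL : 0 < L) (φ : Fin M → ℝ → ℂ)
    (hφ : ∀ i, MemLp (φ i) 2 (volume.restrict (Set.Icc (0 : ℝ) L)))
    (horth : ∀ i j, ∫ x in Set.Icc 0 L, conj (φ i x) * φ j x = if i = j then 1 else 0)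
    (m : ℤ) :
    L * ∑ i, ‖ezCoeff L (φ i) m‖ ^ 2 ≤ 1 := by
  set e : ℝ → ℂ := ez L m with he
  set a : Fin M → ℂ := fun i => ∫ x in Set.Icc 0 L, conj (φ i x) * e x with ha
  have hφ1 : ∀ i, IntegrableOn (φ i) (Set.Icc 0 L) := fun i => integrableOn_of_memLp_two (hφ i)
  have he1 : ∀ x, ‖e x‖ ≤ 1 := fun x => by rw [he, norm_ez]
  have hec : Continuous e := continuous_ez L m
  -- the coefficients: `L φ̂_i(m) = conj a_i`
  have hcoef : ∀ i, (L : ℂ) * ezCoeff L (φ i) m = conj (a i) := by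
    intro i
    rw [mul_ezCoeff hL, ha]
    simp only
    rw [← integral_conj]
    refine integral_congr_ae (Filter.Eventually.of_forall fun x => ?_)
    simp only [map_mul, Complex.conj_conj]
    rw [mul_comm]
  have hq : ∀ i, ‖ezCoeff L (φ i) m‖ = ‖a i‖ / L := by
    intro i
    have h := congrArg (fun z : ℂ => ‖z‖) (hcoef i)
    simp only [norm_mul, Complex.norm_real, Real.norm_eq_abs, abs_of_pos hL,
      Complex.norm_conj] at h
    rw [eq_div_iff hL.ne', mul_comm]
    exact h
  -- the combination `g = ∑ a_i φ_i`
  set g : ℝ → ℂ := fun x => ∑ i, a i * φ i x with hg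
  have hgm : MemLp g 2 (volume.restrict (Set.Icc (0 : ℝ) L)) :=
    memLp_finsetSum Finset.univ fun i _ => (hφ i).const_mul (a i)
  have hg1 : IntegrableOn g (Set.Icc 0 L) := integrableOn_of_memLp_two hgm
  set S : ℝ := ∑ i, ‖a i‖ ^ 2 with hS
  -- four integrals
  have hI_ee : ∫ x in Set.Icc 0 L, conj (e x) * e x = (L : ℂ) := by
    have : (fun x => conj (e x) * e x) = fun x => (1 : ℂ) := by
      funext x
      rw [mul_comm, mul_conj_eq_norm_sq, he, norm_ez]
      simp
    rw [this, setIntegral_const, Real.volume_real_Icc_of_le hL.le, sub_zero, Complex.real_smul,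
      mul_one]
  have hint_eφ : ∀ i, ∫ x in Set.Icc 0 L, conj (e x) * φ i x = conj (a i) := by
    intro i
    rw [ha]
    simp only
    rw [← integral_conj]
    refine integral_congr_ae (Filter.Eventually.of_forall fun x => ?_)
    simp only [map_mul, Complex.conj_conj]
    rw [mul_comm]
  have hInt_eφ : ∀ i, IntegrableOn (fun x => conj (e x) * φ i x) (Set.Icc 0 L) := fun i =>
    Integrable.bdd_mul (c := 1) (hφ1 i) (Complex.continuous_conj.comp hec).aestronglyMeasurable
      (Filter.Eventually.of_forall fun x => by rw [Complex.norm_conj]; exact he1 x)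
  have hI_eg : ∫ x in Set.Icc 0 L, conj (e x) * g x = (S : ℂ) := by
    have hpt : ∀ x, conj (e x) * g x = ∑ i, a i * (conj (e x) * φ i x) := by
      intro x
      simp only [hg, Finset.mul_sum]
      refine Finset.sum_congr rfl fun i _ => ?_
      ring
    simp_rw [hpt]
    rw [integral_finsetSum _ fun i _ => (hInt_eφ i).const_mul (a i)]
    simp_rw [integral_const_mul, hint_eφ, mul_conj_eq_norm_sq, hS]
    push_cast
    rfl
  have hInt_eg : IntegrableOn (fun x => conj (e x) * g x) (Set.Icc 0 L) :=
    Integrable.bdd_mul (c := 1) hg1 (Complex.continuous_conj.comp hec).aestronglyMeasurable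
      (Filter.Eventually.of_forall fun x => by rw [Complex.norm_conj]; exact he1 x)
  have hI_ge : ∫ x in Set.Icc 0 L, conj (g x) * e x = (S : ℂ) := by
    have : (fun x => conj (g x) * e x) = fun x => conj (conj (e x) * g x) := by
      funext x
      rw [map_mul, Complex.conj_conj, mul_comm]
    rw [this, integral_conj, hI_eg, Complex.conj_ofReal]
  have hInt_ge : IntegrableOn (fun x => conj (g x) * e x) (Set.Icc 0 L) :=
    Integrable.mul_bdd (c := 1) (integrableOn_conj hg1) hec.aestronglyMeasurable
      (Filter.Eventually.of_forall fun x => he1 x)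
  have hI_gg : ∫ x in Set.Icc 0 L, conj (g x) * g x = (S : ℂ) := by
    have hpt : ∀ x, conj (g x) * g x = ∑ i, ∑ j, (conj (a i) * a j) * (conj (φ i x) * φ j x) := by
      intro x
      simp only [hg]
      rw [map_sum, Finset.sum_mul]
      refine Finset.sum_congr rfl fun i _ => ?_
      rw [Finset.mul_sum]
      refine Finset.sum_congr rfl fun j _ => ?_
      rw [map_mul]
      ring
    simp_rw [hpt]
    have hint : ∀ i j, IntegrableOn (fun x => (conj (a i) * a j) * (conj (φ i x) * φ j x))
        (Set.Icc 0 L) := fun i j => (integrableOn_conj_mul (hφ i) (hφ j)).const_mul _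
    rw [integral_finsetSum _ fun i _ => integrable_finsetSum _ fun j _ => hint i j]
    simp_rw [integral_finsetSum _ fun j _ => hint _ j, integral_const_mul, horth, mul_ite, mul_one,
      mul_zero, Finset.sum_ite_eq, Finset.mem_univ, if_true, hS]
    push_cast
    refine Finset.sum_congr rfl fun i _ => ?_
    rw [mul_comm, mul_conj_eq_norm_sq]
    push_cast
    ring
  have hInt_gg : IntegrableOn (fun x => conj (g x) * g x) (Set.Icc 0 L) := integrableOn_conj_mul hgm hgm
  have hInt_ee : IntegrableOn (fun x => conj (e x) * e x) (Set.Icc 0 L) :=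
    ((Complex.continuous_conj.comp hec).mul hec).integrableOn_Icc
  -- `0 ≤ ∫|e − g|² = L − S`
  have hpt : ∀ x, ((‖e x - g x‖ ^ 2 : ℝ) : ℂ) =
      conj (e x) * e x - conj (g x) * e x - (conj (e x) * g x - conj (g x) * g x) := by
    intro x
    rw [← mul_conj_eq_norm_sq, map_sub]
    ring
  have hval : ((∫ x in Set.Icc 0 L, ‖e x - g x‖ ^ 2 : ℝ) : ℂ) = ((L - S : ℝ) : ℂ) := by
    rw [← integral_complex_ofReal]
    simp_rw [hpt]
    have hA : IntegrableOn (fun x => conj (e x) * e x - conj (g x) * e x) (Set.Icc 0 L) :=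
      hInt_ee.sub hInt_ge
    have hB : IntegrableOn (fun x => conj (e x) * g x - conj (g x) * g x) (Set.Icc 0 L) :=
      hInt_eg.sub hInt_gg
    rw [integral_sub hA hB, integral_sub hInt_ee hInt_ge, integral_sub hInt_eg hInt_gg,
      hI_ee, hI_ge, hI_eg, hI_gg]
    push_cast
    ring
  have hnonneg : 0 ≤ ∫ x in Set.Icc 0 L, ‖e x - g x‖ ^ 2 := integral_nonneg fun _ => by positivity
  have hSL : S ≤ L := by
    have h := hval
    have h' : (∫ x in Set.Icc 0 L, ‖e x - g x‖ ^ 2) = L - S := by exact_mod_cast h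
    linarith
  -- conclude
  have hsum : L * ∑ i, ‖ezCoeff L (φ i) m‖ ^ 2 = S / L := by
    simp_rw [hq, div_pow, ← Finset.sum_div, ← hS]
    field_simp
  rw [hsum, div_le_one hL]
  exact hSL

/-- **Bessel per mode, summed over the family**: `∑_{m∈K} L ∑_i |φ̂_i(m)|² ≤ M` for `M`
normalised modes (`L ∑_{m∈K} |φ̂_i(m)|² ≤ ∫|φ_i|² = 1`). [folklore] -/
theorem sum_mul_sum_sq_ezCoeff_le_card (hL : 0 < L) (φ : Fin M → ℝ → ℂ)
    (hφ : ∀ i, MemLp (φ i) 2 (volume.restrict (Set.Icc (0 : ℝ) L)))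
    (hnorm : ∀ i, ∫ x in Set.Icc 0 L, conj (φ i x) * φ i x = 1) (K : Finset ℤ) :
    ∑ m ∈ K, L * ∑ i, ‖ezCoeff L (φ i) m‖ ^ 2 ≤ M := by
  calc ∑ m ∈ K, L * ∑ i, ‖ezCoeff L (φ i) m‖ ^ 2
      = ∑ i, L * ∑ m ∈ K, ‖ezCoeff L (φ i) m‖ ^ 2 := by
        simp_rw [Finset.mul_sum]
        rw [Finset.sum_comm]
    _ ≤ ∑ _i : Fin M, (1 : ℝ) := Finset.sum_le_sum fun i _ => by
        have h := mul_sum_sq_ezCoeff_le hL (hφ i) K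
        rw [integral_norm_sq_eq_one_of_orth (hnorm i)] at h
        exact h
    _ = M := by simp

end Family

/-! ### The Ky Fan step (combinatorial part): greedy majorisation -/

/-- **Greedy majorisation.** For non-negative values `c` on a finite set `K` and weights
`w ∈ [0, 1]` of total mass `≤ M`, `∑_{K} c w` is at most the `c`-mass of some subset of `K` with
at most `M` elements (give the largest value the full weight first and recurse on the rest with
the remaining weights scaled down — the vertices of `{0 ≤ w ≤ 1, ∑ w ≤ M}` are the indicator
vectors of the `≤ M`-subsets). [folklore] -/
theorem exists_card_le_sum_mul_le {ι : Type*} [DecidableEq ι] (c : ι → ℝ) (hc : ∀ i, 0 ≤ c i)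
    (K : Finset ι) :
    ∀ w : ι → ℝ, (∀ i, 0 ≤ w i) → (∀ i, w i ≤ 1) → ∀ M : ℕ, ∑ i ∈ K, w i ≤ M →
      ∃ A ⊆ K, A.card ≤ M ∧ ∑ i ∈ K, c i * w i ≤ ∑ i ∈ A, c i := by
  induction K using Finset.induction_on_max_value c with
  | empty =>
      intro w _ _ M _
      exact ⟨∅, Finset.empty_subset _, by simp, by simp⟩
  | insert a s has hmax ih =>
      intro w hw0 hw1 M hM
      rw [Finset.sum_insert has] at hM
      set T : ℝ := ∑ i ∈ s, w i with hT
      have hT0 : 0 ≤ T := Finset.sum_nonneg fun i _ => hw0 i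
      cases M with
      | zero =>
          have hM0 : w a + T ≤ 0 := by exact_mod_cast hM
          have hwa : w a = 0 := by linarith [hw0 a]
          have hTz : T = 0 := by linarith [hw0 a]
          have hwi : ∀ i ∈ s, w i = 0 := fun i hi =>
            (Finset.sum_eq_zero_iff_of_nonneg fun j _ => hw0 j).1 (hT ▸ hTz) i hi
          refine ⟨∅, Finset.empty_subset _, by simp, ?_⟩
          rw [Finset.sum_insert has, Finset.sum_empty, hwa, mul_zero, zero_add]
          exact le_of_eq (Finset.sum_eq_zero fun i hi => by rw [hwi i hi, mul_zero])
      | succ M' =>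
          have hM' : w a + T ≤ M' + 1 := by
            have : w a + T ≤ ((M' + 1 : ℕ) : ℝ) := hM
            push_cast at this
            exact this
          -- mass to remove from `s`: `r = max 0 (T − M')`; `r ≤ 1 − w a`, `r ≤ T`, `T − r ≤ M'`
          set r : ℝ := max 0 (T - M') with hr
          have hr0 : 0 ≤ r := le_max_left _ _
          have hM'0 : (0 : ℝ) ≤ M' := Nat.cast_nonneg M'
          have hrT : r ≤ T := max_le hT0 (by linarith)
          have hrw : r ≤ 1 - w a := max_le (by linarith [hw1 a]) (by linarith)
          have hTr : T - r ≤ M' := by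
            have : T - M' ≤ r := le_max_right _ _
            linarith
          -- the bound `∑_s c w ≤ c a · T` from `c ≤ c a` on `s`
          have hcw : ∑ i ∈ s, c i * w i ≤ c a * T := by
            rw [hT, Finset.mul_sum]
            exact Finset.sum_le_sum fun i hi => mul_le_mul_of_nonneg_right (hmax i hi) (hw0 i)
          by_cases hTz : T = 0
          · -- nothing on `s`: `A = {a}`
            have hcw0 : ∑ i ∈ s, c i * w i ≤ 0 := by rw [hTz, mul_zero] at hcw; exact hcw
            refine ⟨{a}, by simp, by simp, ?_⟩
            rw [Finset.sum_insert has, Finset.sum_singleton]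
            have h1 : c a * w a ≤ c a := by
              calc c a * w a ≤ c a * 1 := mul_le_mul_of_nonneg_left (hw1 a) (hc a)
                _ = c a := mul_one _
            linarith
          · have hTpos : 0 < T := lt_of_le_of_ne hT0 (Ne.symm hTz)
            -- scaled weights on `s`
            set θ : ℝ := 1 - r / T with hθ
            have hθ0 : 0 ≤ θ := by
              rw [hθ, sub_nonneg, div_le_one hTpos]
              exact hrT
            have hθ1 : θ ≤ 1 := by
              have : 0 ≤ r / T := div_nonneg hr0 hT0
              rw [hθ]
              linarith
            set w' : ι → ℝ := fun i => θ * w i with hw'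
            have hw'0 : ∀ i, 0 ≤ w' i := fun i => mul_nonneg hθ0 (hw0 i)
            have hw'1 : ∀ i, w' i ≤ 1 := fun i => by
              calc w' i = θ * w i := rfl
                _ ≤ 1 * 1 := mul_le_mul hθ1 (hw1 i) (hw0 i) zero_le_one
                _ = 1 := mul_one _
            have hsum' : ∑ i ∈ s, w' i = T - r := by
              simp only [hw']
              rw [← Finset.mul_sum, ← hT, hθ]
              field_simp
            obtain ⟨A', hA's, hA'card, hA'le⟩ :=
              ih w' hw'0 hw'1 M' (by rw [hsum']; exact hTr)
            -- split `c w = c w' + (r/T) c w` on `s`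
            have hsplit : ∑ i ∈ s, c i * w i = ∑ i ∈ s, c i * w' i + (r / T) * ∑ i ∈ s, c i * w i := by
              rw [Finset.mul_sum, ← Finset.sum_add_distrib]
              refine Finset.sum_congr rfl fun i _ => ?_
              simp only [hw', hθ]
              ring
            have hrest : (r / T) * ∑ i ∈ s, c i * w i ≤ r * c a := by
              calc (r / T) * ∑ i ∈ s, c i * w i ≤ (r / T) * (c a * T) :=
                    mul_le_mul_of_nonneg_left hcw (div_nonneg hr0 hT0)
                _ = r * c a := by field_simp
            have haA' : a ∉ A' := fun h => has (hA's h)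
            refine ⟨insert a A', Finset.insert_subset_insert a hA's, ?_, ?_⟩
            · rw [Finset.card_insert_of_notMem haA']
              exact Nat.succ_le_succ hA'card
            · rw [Finset.sum_insert has, Finset.sum_insert haA', hsplit]
              have h1 : c a * w a + r * c a ≤ c a := by
                have : c a * (w a + r) ≤ c a * 1 :=
                  mul_le_mul_of_nonneg_left (by linarith) (hc a)
                linarith
              linarith

/-- The greedy lemma against a MONOTONE set bound: if every `A ⊆ K` with `#A ≤ M` has `c`-mass
`≤ F`, then `∑_{K} c w ≤ F` for all weights `w ∈ [0, 1]` of total mass `≤ M`. [folklore] -/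
theorem sum_mul_le_of_forall_card_le {ι : Type*} [DecidableEq ι] {c w : ι → ℝ} {K : Finset ι}
    {M : ℕ} {F : ℝ} (hc : ∀ i, 0 ≤ c i) (hw0 : ∀ i, 0 ≤ w i) (hw1 : ∀ i, w i ≤ 1)
    (hsum : ∑ i ∈ K, w i ≤ M) (hF : ∀ A ⊆ K, A.card ≤ M → ∑ i ∈ A, c i ≤ F) :
    ∑ i ∈ K, c i * w i ≤ F := by
  obtain ⟨A, hAK, hAcard, hle⟩ := exists_card_le_sum_mul_le c hc K w hw0 hw1 M hsum
  exact hle.trans (hF A hAK hAcard)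

/-! ### Assembly: the occupation of an arbitrary `M`-dimensional subspace -/

section Assembly

variable {M : ℕ}

/-- The **occupation of the subspace spanned by the modes `φ₀, …, φ_{M−1}`**:
`Tr(P_V γ_N) = ∑_i Re⟨φ_i, γ_N φ_i⟩` for an orthonormal family (for a general family, the sum of
the expected occupations of its members). [cite: ForresterEtAl2003, §3.1] -/
def subspaceOccupation (N : ℕ) (L : ℝ) (φ : Fin M → ℝ → ℂ) : ℝ :=
  ∑ i, (girardeauForm N L (φ i)).re

/-- No particles, no occupation. [folklore] -/
theorem subspaceOccupation_zero_left (L : ℝ) (φ : Fin M → ℝ → ℂ) :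
    subspaceOccupation 0 L φ = 0 := by
  simp [subspaceOccupation, girardeauForm, girardeauDensityMatrix]

/-- `Tr(P_V γ_N) ≥ 0`. [cite: ForresterEtAl2003, §2.1.2] -/
theorem subspaceOccupation_nonneg (N : ℕ) (L : ℝ) (φ : Fin M → ℝ → ℂ)
    (hφ : ∀ i, MemLp (φ i) 2 (volume.restrict (Set.Icc (0 : ℝ) L))) :
    0 ≤ subspaceOccupation N L φ :=
  Finset.sum_nonneg fun i _ => girardeauForm_re_nonneg N L (integrableOn_of_memLp_two (hφ i))

/-- **The Ky Fan reduction, typed.** For `N ≥ 1`, `L > 0` and an orthonormal family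
`φ₀, …, φ_{M−1}` in `L²[0, L]`, the subspace occupation is the limit of
`∑_{m∈K} c_m(N) w_m` along `K ↑ ℤ`, with the weights `w_m = L ∑_i |φ̂_i(m)|² = ∑_i |⟨e_m/√L, φ_i⟩|²`
(`0 ≤ w_m ≤ 1` by Bessel across the family, `∑_{m∈K} w_m ≤ M` by Bessel per mode).
[cite: ForresterEtAl2003, §3.1.3] -/
theorem tendsto_sum_weights_subspaceOccupation (hL : 0 < L) (n : ℕ) (φ : Fin M → ℝ → ℂ)
    (hφ : ∀ i, MemLp (φ i) 2 (volume.restrict (Set.Icc (0 : ℝ) L))) :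
    Tendsto (fun K : Finset ℤ => ∑ m ∈ K, momentumOccupation (n + 1) L m *
        (L * ∑ i, ‖ezCoeff L (φ i) m‖ ^ 2)) atTop (𝓝 (subspaceOccupation (n + 1) L φ)) := by
  have h : Tendsto (fun K : Finset ℤ => ∑ i, L * ∑ m ∈ K,
      momentumOccupation (n + 1) L m * ‖ezCoeff L (φ i) m‖ ^ 2) atTop
      (𝓝 (subspaceOccupation (n + 1) L φ)) :=
    tendsto_finsetSum _ fun i _ => tendsto_sum_momentumOccupation_mul_sq hL n (hφ i)
  refine h.congr fun K => ?_
  simp_rw [Finset.mul_sum]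
  rw [Finset.sum_comm]
  refine Finset.sum_congr rfl fun m _ => Finset.sum_congr rfl fun i _ => ?_
  ring

/-- **Ky Fan bound for Girardeau's gas: no generalised condensation in ANY subspace of
`o(N/log N)` dimensions.** For all `N`, `L > 0` and every orthonormal family `φ₀, …, φ_{M−1}` of
square-integrable modes on `[0, L]` (`∫₀ᴸ conj(φ_i) φ_j = δ_{ij}`):
`Tr(P_V γ_N) = ∑_i ⟨φ_i, γ_N φ_i⟩ ≤ 7e √(N M (1 + log M))` — the occupation of an ARBITRARY
`M`-dimensional one-particle subspace is bounded by the family law of `OneDimensionalHardCoreFamilies`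
for the `M` largest momentum occupations (`γ_N` is diagonal in the plane waves with eigenvalues
`c_m(N) ≥ 0`; Bessel; greedy majorisation; `familyOccupation_le_of_card_le`).
[cite: ForresterEtAl2003, §2.2.2 and §3.1.3] [cite: DeiftItsKrasovsky2013, Remark 8 (r34-1)–(r34-2)] -/
theorem subspaceOccupation_le (N : ℕ) (hL : 0 < L) (φ : Fin M → ℝ → ℂ)
    (hφ : ∀ i, MemLp (φ i) 2 (volume.restrict (Set.Icc (0 : ℝ) L)))
    (horth : ∀ i j, ∫ x in Set.Icc 0 L, conj (φ i x) * φ j x = if i = j then 1 else 0) :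
    subspaceOccupation N L φ ≤ 7 * Real.exp 1 * Real.sqrt N * Real.sqrt (M * (1 + Real.log M)) := by
  cases N with
  | zero =>
      rw [subspaceOccupation_zero_left]
      positivity
  | succ n =>
      set c : ℤ → ℝ := fun m => momentumOccupation (n + 1) L m with hc
      set w : ℤ → ℝ := fun m => L * ∑ i, ‖ezCoeff L (φ i) m‖ ^ 2 with hw
      have hc0 : ∀ m, 0 ≤ c m := fun m => momentumOccupation_nonneg hL (n + 1) m
      have hw0 : ∀ m, 0 ≤ w m := fun m =>
        mul_nonneg hL.le (Finset.sum_nonneg fun i _ => by positivity)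
      have hw1 : ∀ m, w m ≤ 1 := fun m => mul_sum_sq_ezCoeff_family_le_one hL φ hφ horth m
      have hnorm : ∀ i, ∫ x in Set.Icc 0 L, conj (φ i x) * φ i x = 1 := fun i => by
        rw [horth i i, if_pos rfl]
      have hwsum : ∀ K : Finset ℤ, ∑ m ∈ K, w m ≤ M := fun K =>
        sum_mul_sum_sq_ezCoeff_le_card hL φ hφ hnorm K
      have hlim := tendsto_sum_weights_subspaceOccupation hL n φ hφ
      refine le_of_tendsto' hlim fun K => ?_
      show ∑ m ∈ K, c m * w m ≤ _
      refine sum_mul_le_of_forall_card_le hc0 hw0 hw1 (hwsum K) fun A _ hA => ?_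
      exact familyOccupation_le_of_card_le (n + 1) hL hA

/-- The same bound for every family of AT MOST `o(N/log N)` modes along a sequence:
**`Tr(P_{V_N} γ_N)/N → 0` whenever `dim V_N (1 + log dim V_N)/N → 0`**.
[cite: ForresterEtAl2003, §2.2.2 and §3.1.3] -/
theorem tendsto_subspaceOccupation_div (hL : 0 < L) {M : ℕ → ℕ} (φ : (N : ℕ) → Fin (M N) → ℝ → ℂ)
    (hφ : ∀ N i, MemLp (φ N i) 2 (volume.restrict (Set.Icc (0 : ℝ) L)))
    (horth : ∀ N i j, ∫ x in Set.Icc 0 L, conj (φ N i x) * φ N j x = if i = j then 1 else 0)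
    (hM : Tendsto (fun N : ℕ => ((M N : ℝ) * (1 + Real.log (M N))) / N) atTop (𝓝 0)) :
    Tendsto (fun N : ℕ => subspaceOccupation N L (φ N) / N) atTop (𝓝 0) := by
  have hmaj : Tendsto (fun N : ℕ => 7 * Real.exp 1 *
      Real.sqrt (((M N : ℝ) * (1 + Real.log (M N))) / N)) atTop (𝓝 0) := by
    have h := (Real.continuous_sqrt.tendsto 0).comp hM
    rw [Real.sqrt_zero] at h
    have h2 := h.const_mul (7 * Real.exp 1)
    rw [mul_zero] at h2
    exact h2
  refine squeeze_zero' ?_ ?_ hmaj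
  · filter_upwards [Filter.eventually_ge_atTop 1] with N hN
    exact div_nonneg (subspaceOccupation_nonneg N L (φ N) (hφ N)) (Nat.cast_nonneg N)
  · filter_upwards [Filter.eventually_ge_atTop 1] with N hN
    have hNpos : (0 : ℝ) < N := by exact_mod_cast hN
    have h := subspaceOccupation_le N hL (φ N) (hφ N) (horth N)
    rw [div_le_iff₀ hNpos]
    set X : ℝ := (M N : ℝ) * (1 + Real.log (M N)) with hX
    have hsN0 : Real.sqrt (N : ℝ) ≠ 0 := (Real.sqrt_pos.2 hNpos).ne'
    have key : Real.sqrt (N : ℝ) * Real.sqrt X = Real.sqrt (X / N) * N := by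
      rw [Real.sqrt_div' _ hNpos.le, div_mul_eq_mul_div, eq_div_iff hsN0]
      calc Real.sqrt (N : ℝ) * Real.sqrt X * Real.sqrt N
          = Real.sqrt X * (Real.sqrt N * Real.sqrt N) := by ring
        _ = Real.sqrt X * N := by rw [Real.mul_self_sqrt hNpos.le]
    calc subspaceOccupation N L (φ N)
        ≤ 7 * Real.exp 1 * Real.sqrt N * Real.sqrt X := h
      _ = 7 * Real.exp 1 * Real.sqrt (X / N) * N := by
          rw [mul_assoc (7 * Real.exp 1), key, ← mul_assoc]

/-- **No linear occupation of any `o(N/log N)`-dimensional subspace**: there is no `c > 0` with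
`cN ≤ Tr(P_{V_N} γ_N)` for all large `N` when `dim V_N (1 + log dim V_N)/N → 0`.
[cite: ForresterEtAl2003, §2.2.2 and §3.1.3] -/
theorem not_exists_linear_le_subspaceOccupation (hL : 0 < L) {M : ℕ → ℕ}
    (φ : (N : ℕ) → Fin (M N) → ℝ → ℂ)
    (hφ : ∀ N i, MemLp (φ N i) 2 (volume.restrict (Set.Icc (0 : ℝ) L)))
    (horth : ∀ N i j, ∫ x in Set.Icc 0 L, conj (φ N i x) * φ N j x = if i = j then 1 else 0)
    (hM : Tendsto (fun N : ℕ => ((M N : ℝ) * (1 + Real.log (M N))) / N) atTop (𝓝 0)) :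
    ¬ ∃ c : ℝ, 0 < c ∧ ∀ᶠ N : ℕ in atTop, c * N ≤ subspaceOccupation N L (φ N) := by
  rintro ⟨c, hc, hev⟩
  have ht := tendsto_subspaceOccupation_div hL φ hφ horth hM
  have hev' : ∀ᶠ N : ℕ in atTop, c ≤ subspaceOccupation N L (φ N) / N := by
    filter_upwards [hev, Filter.eventually_ge_atTop 1] with N hN hN1
    have hNpos : (0 : ℝ) < N := by exact_mod_cast hN1
    rwa [le_div_iff₀ hNpos]
  have hlim : c ≤ 0 := ge_of_tendsto ht hev'
  linarith

/-- Consistency: the one-member family `φ₀ = L^{-1/2}` (the constant mode) has subspace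
occupation `c₀(N)`. [cite: ForresterEtAl2003, §2.2.1] -/
theorem subspaceOccupation_const (hL : 0 < L) (N : ℕ) :
    subspaceOccupation N L (fun _ : Fin 1 => fun _ : ℝ => ((Real.sqrt L)⁻¹ : ℂ)) =
      zeroMomentumOccupation N L := by
  unfold subspaceOccupation
  rw [Fin.sum_univ_one]
  have h : girardeauForm N L (fun _ : ℝ => ((Real.sqrt L)⁻¹ : ℂ)) =
      ((Real.sqrt L)⁻¹ : ℂ) ^ 2 * girardeauForm N L (fun _ => (1 : ℂ)) := by
    unfold girardeauForm
    rw [← integral_const_mul]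
    refine integral_congr_ae (Filter.Eventually.of_forall fun x => ?_)
    simp only
    rw [← integral_const_mul]
    refine integral_congr_ae (Filter.Eventually.of_forall fun y => ?_)
    simp only [map_inv₀, Complex.conj_ofReal, map_one, mul_one]
    ring
  rw [h, girardeauForm_const_one hL N]
  have hs : ((Real.sqrt L : ℂ))⁻¹ ^ 2 = ((L : ℂ))⁻¹ := by
    rw [inv_pow, ← Complex.ofReal_pow, Real.sq_sqrt hL.le]
  rw [hs]
  simp only [Complex.mul_re, Complex.inv_re, Complex.inv_im, Complex.ofReal_re, Complex.ofReal_im,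
    Complex.normSq_ofReal]
  field_simp
  ring

end Assembly

end Literature.Barriers.AtomisticToContinuum.BoseGas

namespace Literature.Barriers.AtomisticToContinuum

open BoseGas

/-- **No generalised Bose–Einstein condensation in ANY one-particle subspace of `o(N/log N)`
dimensions for impenetrable bosons on the ring (Girardeau–Lenard–Szegő, subspace / Ky Fan form).**
For every circumference `L > 0`, every sequence of dimensions `M_N` with `M_N(1 + log M_N)/N → 0`
and EVERY choice of orthonormal families `φ^{(N)}_0, …, φ^{(N)}_{M_N−1}` of square-integrable modes on
`[0, L]` (`∫₀ᴸ conj(φ_i)φ_j = δ_{ij}`; no restriction whatsoever on what the modes are — plane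
waves, localised orbitals, wave packets), the occupation of the subspace they span in Girardeau's
ground state of `N` impenetrable bosons, `Tr(P_{V_N}γ_N) = ∑_i ⟨φ_i, γ_N φ_i⟩`
(`subspaceOccupation`), is `o(N)`. Quantitatively, for ALL `N`, `L`, `M` and every such family:
`Tr(P_V γ_N) ≤ 7e√N√(M(1 + log M))` (`subspaceOccupation_le`). Mechanism (typed): the natural
orbitals on the circle are the plane waves — "the periodicity implies that the natural orbitals are
simply plane waves, and so the eigenvalues are given by the Fourier coefficients of `ρ_N(x−y)`"
[cite: ForresterEtAl2003, §3.1.3] — in the strong form `⟨φ, γ_Nφ⟩ = ∑_{m∈ℤ} c_m(N)|⟨e_m/√L, φ⟩|²`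
for every `φ ∈ L²[0, L]` (`hasSum_momentumOccupation_mul_sq_ezCoeff`), so
`Tr(P_Vγ_N) = ∑_m c_m w_m` with Bessel weights `0 ≤ w_m ≤ 1`, `∑_m w_m ≤ M`, which greedy
majorisation (`c_m ≥ 0`) bounds by the `M` largest momentum occupations, i.e. by the family law
`7e√(NM(1 + log M))` of `OneDimensionalHardCoreFamilies` [cite: ForresterEtAl2003, §2.2.2]
[cite: DeiftItsKrasovsky2013, Remark 8 (r34-1)–(r34-2)].
BARRIER (D-0021), AtomisticToContinuum/BoseEinsteinCondensation:
technique_class: dimension-independent coupling-independent interaction-independent ground-state repulsive-generic generalized-condensation arbitrary-subspace ky-fan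
blocks: everything `OneDimensionalHardCore` / `…Narrow` / `…Bands` / `…Families` block (single-mode `λ_max ≥ cN`, super-`√N` single modes, bands and plane-wave families of `o(N/log N)` modes, by arguments valid verbatim for the impenetrable ring gas in the thermodynamic limit) AND, in addition, every such argument whose conclusion — or whose first, dimension-free step — is generalised condensation `Tr(P_{V_N}γ_N) ≥ εN` into an ARBITRARY one-particle subspace `V_N ⊂ L²` of dimension `M_N = o(N/log N)` that is NOT tied to momentum space: localised or wavelet-type orbitals, coherent states, eigenmodes of an auxiliary one-body operator, or "some `M_N ≤ N^{1−δ}` orthonormal modes carry `≥ εN` particles" obtained by compactness / entropy / pigeonhole without locating the modes (to be followed by a `d = 3` concentration step) — false for Girardeau's gas for EVERY orthonormal family and every `N` (typed here: `subspaceOccupation_le`, `not_exists_linear_le_subspaceOccupation`)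
because: Lenard's formula `ρ_N(x, y) = L⁻¹R_{N−1}(2π(x−y)/L)` makes `γ_N` a convolution on the ring, so `γ_N e_m = c_m e_m` (`densityApply_ez`) and `⟨e_m, γ_N e_{m'}⟩ = Lc_mδ_{mm'}` (`girardeauForm₂_ez_ez`); the form is bounded on `L¹` by the global kernel bound `ρ_N ≤ (N/L)e^{1/2}` and the Fourier partial sums of an `L²` mode converge in `L²[0, L]` (Parseval, Mathlib's `hasSum_sq_fourierCoeffOn`), hence in `L¹`, so `⟨φ, γ_Nφ⟩ = ∑_m c_m·L|φ̂(m)|²` (`hasSum_momentumOccupation_mul_sq_ezCoeff`); for an orthonormal family `w_m = L∑_i|φ̂_i(m)|² ≤ 1` (Bessel across the family: `0 ≤ ∫|e_m − ∑_i⟨φ_i, e_m⟩φ_i|² = L − ∑_i|⟨φ_i, e_m⟩|²`, `mul_sum_sq_ezCoeff_family_le_one`) and `∑_{m∈K} w_m ≤ M` (Bessel per mode), and for `c ≥ 0`, `0 ≤ w ≤ 1`, `∑w ≤ M` the greedy exchange gives `∑ c w ≤ max_{#A ≤ M}∑_A c` (`exists_card_le_sum_mul_le`); the right-hand side is `≤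 7e√(NM(1 + log M))` by `familyOccupation_le_of_card_le` (Szegő's inequality `R(n,t) ≤ 2e√(n+1)/√|sin(t/2)|` [cite: DeiftItsKrasovsky2013, Remark 8 (r34-2)])
evasions_known: exactly those of `OneDimensionalHardCore` (i)–(x): use `d = 3` (or `d ≥ 2` at `T = 0`) essentially, or a weak-coupling (Gross–Pitaevskii / Bogoliubov) mechanism; subspaces of dimension `Θ(N/log N) … Θ(N)` are NOT excluded by anything typed (`∑_m c_m = N`: the `N` lowest plane waves carry `Θ(N)` particles; the window `N/log N ≲ M_N = o(N)` is open in the tree and needs the per-mode law `c_m ≤ C√(N/|m|)`, parent caveat (t)(3)); NON-orthonormal or overcomplete families are covered through the subspace they span (`Tr Pγ_N`), not through the sum of their individual occupations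
scope_caveats: (a) typed for the ZERO-RANGE impenetrable gas on the PERIODIC ring only; hard rods (whose `γ` is also plane-wave diagonal, `OneDimensionalHardCoreRodsShift`), Dirichlet / Neumann walls (no translation invariance, natural orbitals not explicit — only the uniform single-mode `o(N)` of `OneDimensionalHardCoreDirichlet` is typed) and traps are not typed in subspace form; (b) `γ_N` is not constructed as a trace-class operator on `L²[0, L]`: typed are its quadratic form, the diagonalisation as an unconditional sum, and `Tr(Pγ_N)` for the finite-rank projections given by orthonormal families — which is everything the conjunct's finite-rank generalisations of `∃ φ, cN‖φ‖² ≤ ⟨φ, γ_Nφ⟩` quantify over; (c) the constant `7e` and the factor `√(1 + log M)` are artefacts of the proof (printed order `≈ 4ρ_∞√(πNM)` for the `M` lowest modes [cite: ForresterEtAl2003, §2.2.2]); (d) [cite: Lenard1964, as restated in DeiftItsKrasovsky2013 Remark 8] not re-read (cite-only, acq-00347)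
status: established (proved below, `oneDimensionalHardCoreSubspaces_holds`; seventeenth audit of `OneDimensionalHardCore`, 2026-08-17)
[cite: ForresterEtAl2003, §3.1.3 and §2.2.2] [cite: DeiftItsKrasovsky2013, Remark 8 (r34-1)–(r34-2)] -/
def OneDimensionalHardCoreSubspaces : Prop :=
  ∀ L : ℝ, 0 < L → ∀ (M : ℕ → ℕ) (φ : (N : ℕ) → Fin (M N) → ℝ → ℂ),
    (∀ N i, MemLp (φ N i) 2 (volume.restrict (Set.Icc (0 : ℝ) L))) →
    (∀ N i j, ∫ x in Set.Icc 0 L, conj (φ N i x) * φ N j x = if i = j then 1 else 0) →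
    Tendsto (fun N : ℕ => ((M N : ℝ) * (1 + Real.log (M N))) / N) atTop (𝓝 0) →
      Tendsto (fun N : ℕ => subspaceOccupation N L (φ N) / N) atTop (𝓝 0)

/-- **The subspace barrier holds** (from `tendsto_subspaceOccupation_div`).
[cite: ForresterEtAl2003, §3.1.3 and §2.2.2] [cite: DeiftItsKrasovsky2013, Remark 8 (r34-1)–(r34-2)] -/
theorem oneDimensionalHardCoreSubspaces_holds : OneDimensionalHardCoreSubspaces :=
  fun _ hL _ φ hφ horth hM => tendsto_subspaceOccupation_div hL φ hφ horth hM

/-- Consistency with the parent entry: the subspace barrier for the one-dimensional subspaces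
`V_N = ℂ·1` (the constant mode `L^{-1/2}`) is `c₀(N)/N → 0`, i.e. `OneDimensionalHardCore`.
[cite: ForresterEtAl2003, §2.2.1] -/
theorem oneDimensionalHardCore_of_subspaces (h : OneDimensionalHardCoreSubspaces) :
    OneDimensionalHardCore := by
  intro L hL
  set φ : (N : ℕ) → Fin 1 → ℝ → ℂ := fun _ _ _ => ((Real.sqrt L)⁻¹ : ℂ) with hφ
  have hmem : ∀ N (i : Fin 1), MemLp (φ N i) 2 (volume.restrict (Set.Icc (0 : ℝ) L)) :=
    fun N i => memLp_const _
  have horth : ∀ N (i j : Fin 1),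
      ∫ x in Set.Icc 0 L, conj (φ N i x) * φ N j x = if i = j then 1 else 0 := by
    intro N i j
    have hij : i = j := Subsingleton.elim i j
    subst hij
    rw [if_pos rfl]
    simp only [hφ, map_inv₀, Complex.conj_ofReal]
    rw [setIntegral_const, Real.volume_real_Icc_of_le hL.le, sub_zero, Complex.real_smul,
      ← mul_inv, ← Complex.ofReal_mul, Real.mul_self_sqrt hL.le,
      mul_inv_cancel₀ (by exact_mod_cast hL.ne')]
  have h0 := h L hL (fun _ => 1) φ hmem horth (by
    simp only [Nat.cast_one, Real.log_one, add_zero, mul_one]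
    exact tendsto_const_div_atTop_nhds_zero_nat 1)
  refine h0.congr' (Eventually.of_forall fun N => ?_)
  simp only [hφ]
  rw [subspaceOccupation_const hL N]

end Literature.Barriers.AtomisticToContinuum

end
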